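import Literature.Topology.FourManifolds.NeckCapping
import Literature.Topology.FourManifolds.ConnectedSumTube
import Literature.Topology.FourManifolds.BallStretch
import Literature.Topology.FourManifolds.SmoothTwoDiscCover
import Literature.Topology.FourManifolds.DehnSurgeryTubularNbhdProofs
import Literature.Topology.FourManifolds.MonotoneInverse
import HarnessLib

/-!
# Cutting a collared ball off a manifold along a neck read in a second collar chart

Local model of one surgery of the reconstruction of a manifold from the pieces of the Ricci flow
with surgery (R. Hamilton, *Four-manifolds with positive isotropic curvature*, Comm. Anal. Geom.
5 (1997), §1.1 pp. 3–4: "we replace `S³ × B¹` with two copies of the ball `B⁴` by cutting the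
neck and rounding off the ends"; B.-L. Chen, X.-P. Zhu, J. Differential Geom. 74 (2006),
Thm. 1.1 (iii): the pieces of `M_k ∖ N_k` and of `M_{k+1} ∖ N_k` are balls attached to the
common part `N_k`). The situation (`BallCollarData`): in a manifold `P` modelled on a real inner
product space `E` of dimension `n + 1` we are given

* a **ball piece** `X = ι (B(0,1))`, `ι : E ↪ P` a smooth embedding, and
* a **collar chart** `c : E ⇀ P` (an open partial diffeomorphism defined on the shell
  `1 - δ < ‖y‖ < 1 + ε`) reading a collar of the boundary sphere of `X` *from the other side*:
  `c (𝕊) = ι (𝕊)` (the same sphere), `c {1 - δ < ‖y‖ < 1} ⊆ X`, and `c {1 ≤ ‖y‖ < 1 + ε}`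
  disjoint from `X`

— in the application `ι` is the chart of a piece of `M_k ∖ N_k` and `c = Φ⁻¹ ∘ ι'` is the
chart of the corresponding surgery ball of `M_{k+1}` pulled back by the identification `Φ` of
the common parts, so that the two charts agree only *setwise* along the sphere. We then:

* §2 build the **collar neck** `ψ (θ, τ) = c ((1 + ε ρ τ) • θ)` (`ρ = tubeProfile : ℝ ≅ (0,1)`,
  `ConnectedSumTube.lean`), a smooth embedding `𝕊ⁿ × ℝ ↪ P` with range `c {1 < ‖y‖ < 1 + ε}`;
* §3 exhibit its **two sides explicitly** (no hypothesis on `π₁`): the *near side*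
  `Y = X ∪ c {1 ≤ ‖y‖ < 1 + ε/2}` of the flipped neck and the *far side* `P ∖ (Y ∪ c (𝕊_{1+ε/2}))`
  of `ψ`, as `NeckCapData` (`NeckCapping.lean`), disjoint and covering `P` off the middle sphere
  — exactly the data of the `surgery` constructor of
  `Literature.Geometry.Riemannian.IsNeckSurgeryResolvable`;
* §4 show that **the capped near side is covered by two ambient discs**
  (`SmoothTwoDiscCover`, `SmoothTwoDiscCover.lean`): the closure of the ball piece
  `F_A = inl ∘ ι ∘ ballStretch` and the disc `F_B` made of the cap and the collar
  `c {1 ≤ ‖y‖ ≤ 1 + ε/2}`, read radially (`F_B (s θ) = inr (g s • θ)` inside, `= inl (c ((1 +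
  4 ε (1 - s)) θ))` near and beyond the unit sphere, the two formulas agreeing for `s ≥ 17/18`
  by the design `g s = 1/(1 - s)` there and `ρ (-τ) = 4/τ` for `τ ≥ 18`). Hence (§5, `n + 1 =
  4`, **Cerf's `Γ₄ = 0`**) the capped near side — a twisted sphere `D⁴ ∪_φ D⁴` along the
  transition `φ = c⁻¹ ∘ ι |_{S³}` — is diffeomorphic to `S⁴`.

This is the local, purely differential-topological content of the step "throw away the pieces
diffeomorphic to the standard models" when the manifold is cut along the necks adapted to the
surgery balls of the *next* stage (module docstring of
`Literature/Geometry/Riemannian/SurgicalRicciFlowTopology.lean`: the collars are matched only up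
to `Diff(S³)`, whence Cerf).

## References

* R. S. Hamilton, *Four-manifolds with positive isotropic curvature*, Comm. Anal. Geom. 5 (1997)
  1–92, §1.1 pp. 3–4. [Hamilton1997]
* B.-L. Chen, X.-P. Zhu, *Ricci flow with surgery on four-manifolds with positive isotropic
  curvature*, J. Differential Geom. 74 (2006), Thm. 1.1. [ChenZhu2006]
* M. Kervaire, J. Milnor, *Groups of homotopy spheres I*, Ann. of Math. 77 (1963), §1.
  [KervaireMilnor1963]
* J. Cerf, *Sur les difféomorphismes de la sphère de dimension trois (Γ₄ = 0)*, LNM 53 (1968).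
  [Cerf1968]
-/

open scoped Manifold ContDiff Topology
open Set Function Metric Module Filter OpenPartialHomeomorph Topology

noncomputable section

namespace Literature.Topology.FourManifolds

open TubeProfile

/-! ### §0 Generic lemmas -/

section Generic

variable {EM : Type*} [NormedAddCommGroup EM] [NormedSpace ℝ EM] {HM : Type*} [TopologicalSpace HM]
  {IM : ModelWithCorners ℝ EM HM} {M : Type*} [TopologicalSpace M] [ChartedSpace HM M]
  {EN : Type*} [NormedAddCommGroup EN] [NormedSpace ℝ EN] {HN : Type*} [TopologicalSpace HN]
  {IN : ModelWithCorners ℝ EN HN} {N : Type*} [TopologicalSpace N] [ChartedSpace HN N]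

/-- **A map with a differentiable local left inverse has injective differential**: if
`g ∘ f = id` near `x` then `mfderiv f x` is injective (chain rule). [folklore] -/
theorem mfderiv_injective_of_eventuallyEq_leftInverse {f : M → N} {g : N → M} {x : M}
    (hf : MDifferentiableAt IM IN f x) (hg : MDifferentiableAt IN IM g (f x))
    (h : g ∘ f =ᶠ[𝓝 x] id) : Injective (mfderiv IM IN f x) := by
  have hcomp : mfderiv IM IM (g ∘ f) x = (mfderiv IN IM g (f x)).comp (mfderiv IM IN f x) :=
    mfderiv_comp x hg hf
  have hid : mfderiv IM IM (g ∘ f) x = ContinuousLinearMap.id ℝ (TangentSpace IM x) := by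
    rw [h.mfderiv_eq]
    exact mfderiv_id
  intro v w hvw
  have := congrArg (mfderiv IN IM g (f x)) hvw
  rw [← ContinuousLinearMap.comp_apply, ← ContinuousLinearMap.comp_apply, ← hcomp, hid] at this
  exact this

end Generic

section Euclid

variable {E : Type*} [NormedAddCommGroup E] [InnerProductSpace ℝ E] [FiniteDimensional ℝ E]

/-- **An open set containing the closed unit ball contains a larger open ball** (compactness of
closed balls in finite dimension). [folklore] -/
theorem exists_ball_subset_of_closedBall_subset {U : Set E} (hU : IsOpen U) (h : closedBall (0 : E) 1 ⊆ U) :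
    ∃ R : ℝ, 1 < R ∧ ball (0 : E) R ⊆ U := by
  set K : Set E := closedBall 0 2 ∩ Uᶜ with hK
  have hKc : IsCompact K := (isCompact_closedBall 0 2).inter_right hU.isClosed_compl
  by_cases hne : K.Nonempty
  · obtain ⟨z₀, hz₀, hmin⟩ := hKc.exists_isMinOn hne continuous_norm.continuousOn
    have hz₀1 : 1 < ‖z₀‖ := by
      by_contra hle
      exact hz₀.2 (h (mem_closedBall_zero_iff.2 (not_lt.1 hle)))
    refine ⟨min ‖z₀‖ 2, lt_min hz₀1 (by norm_num), fun x hx => ?_⟩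
    rw [mem_ball_zero_iff, lt_min_iff] at hx
    by_contra hxU
    have hxK : x ∈ K := ⟨mem_closedBall_zero_iff.2 hx.2.le, hxU⟩
    exact (not_le.2 hx.1) (hmin hxK)
  · refine ⟨2, by norm_num, fun x hx => ?_⟩
    by_contra hxU
    exact hne ⟨x, mem_closedBall_zero_iff.2 (le_of_lt (mem_ball_zero_iff.1 hx)), hxU⟩

end Euclid

/-! ### §1 The radii of the collar neck -/

namespace CollarProfile

section Radius

variable {ε : ℝ}

/-- The radius `r τ = 1 + ε ρ τ` of the collar neck (`ρ = tubeProfile`). [folklore] -/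
def collarRad (ε τ : ℝ) : ℝ := 1 + ε * tubeProfile τ

/-- `1 < r τ`. [folklore] -/
theorem one_lt_collarRad (hε : 0 < ε) (τ : ℝ) : 1 < collarRad ε τ := by
  unfold collarRad; nlinarith [tubeProfile_pos τ]

/-- `0 < r τ`. [folklore] -/
theorem collarRad_pos (hε : 0 < ε) (τ : ℝ) : 0 < collarRad ε τ := by linarith [one_lt_collarRad hε τ]

/-- `r τ < 1 + ε`. [folklore] -/
theorem collarRad_lt (hε : 0 < ε) (τ : ℝ) : collarRad ε τ < 1 + ε := by
  unfold collarRad; nlinarith [tubeProfile_lt_one τ]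

/-- `r 0 = 1 + ε/2`. [folklore] -/
theorem collarRad_zero (ε : ℝ) : collarRad ε 0 = 1 + ε / 2 := by
  rw [collarRad, tubeProfile_zero]; ring

/-- `r` is strictly increasing. [folklore] -/
theorem strictMono_collarRad (hε : 0 < ε) : StrictMono (collarRad ε) := fun a b hab => by
  unfold collarRad
  have := strictMono_tubeProfile hab
  nlinarith

/-- `r 0 < r τ ↔ 0 < τ`. [folklore] -/
theorem collarRad_zero_lt_iff (hε : 0 < ε) {τ : ℝ} : collarRad ε 0 < collarRad ε τ ↔ 0 < τ :=
  (strictMono_collarRad hε).lt_iff_lt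

/-- `r τ < r 0 ↔ τ < 0`. [folklore] -/
theorem collarRad_lt_zero_iff (hε : 0 < ε) {τ : ℝ} : collarRad ε τ < collarRad ε 0 ↔ τ < 0 :=
  (strictMono_collarRad hε).lt_iff_lt

/-- `r` is injective. [folklore] -/
theorem injective_collarRad (hε : 0 < ε) : Injective (collarRad ε) := (strictMono_collarRad hε).injective

/-- `r` is smooth. [folklore] -/
theorem contDiff_collarRad (ε : ℝ) : ContDiff ℝ ∞ (collarRad ε) :=
  contDiff_const.add (contDiff_const.mul contDiff_tubeProfile)

/-- The flipped radius: `r (-τ) = 2 + ε - r τ`, i.e. `1 + ε (1 - ρ τ)`. [folklore] -/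
theorem collarRad_neg (ε τ : ℝ) : collarRad ε (-τ) = 1 + ε * (1 - tubeProfile τ) := by
  rw [collarRad, tubeProfile_neg]

/-- Far out on the negative side, `r (-τ) = 1 + 4 ε / τ` (`τ ≥ 18`). [folklore] -/
theorem collarRad_neg_of_ge {τ : ℝ} (h : 18 ≤ τ) : collarRad ε (-τ) = 1 + 4 * ε / τ := by
  rw [collarRad, tubeProfile_of_le_neg (by linarith)]
  ring

/-- The inverse radius `r⁻¹ u = ρ⁻¹ ((u - 1)/ε)`. [folklore] -/
def collarRadInv (ε u : ℝ) : ℝ := tubeProfileInv ((u - 1) / ε)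

/-- `r⁻¹ (r τ) = τ`. [folklore] -/
theorem collarRadInv_collarRad (hε : 0 < ε) (τ : ℝ) : collarRadInv ε (collarRad ε τ) = τ := by
  rw [collarRadInv, collarRad, add_sub_cancel_left, mul_div_cancel_left₀ _ hε.ne', tubeProfileInv_tubeProfile]

/-- `(u - 1)/ε ∈ (0, 1)` for `u ∈ (1, 1 + ε)`. [folklore] -/
theorem div_mem_Ioo_of_mem (hε : 0 < ε) {u : ℝ} (hu : u ∈ Ioo 1 (1 + ε)) : (u - 1) / ε ∈ Ioo (0 : ℝ) 1 := by
  constructor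
  · exact div_pos (by linarith [hu.1]) hε
  · rw [div_lt_one hε]; linarith [hu.2]

/-- `r (r⁻¹ u) = u` for `u ∈ (1, 1 + ε)`. [folklore] -/
theorem collarRad_collarRadInv (hε : 0 < ε) {u : ℝ} (hu : u ∈ Ioo 1 (1 + ε)) : collarRad ε (collarRadInv ε u) = u := by
  rw [collarRad, collarRadInv, tubeProfile_tubeProfileInv (div_mem_Ioo_of_mem hε hu)]
  field_simp
  ring

/-- `r⁻¹` is smooth at the points of `(1, 1 + ε)`. [folklore] -/
theorem contDiffAt_collarRadInv (hε : 0 < ε) {u : ℝ} (hu : u ∈ Ioo 1 (1 + ε)) : ContDiffAt ℝ ∞ (collarRadInv ε) u :=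
  (contDiffAt_tubeProfileInv' (div_mem_Ioo_of_mem hε hu)).comp u
    ((contDiffAt_id.sub contDiffAt_const).div_const ε)

end Radius

end CollarProfile

open CollarProfile

/-! ### §2 Collar data and the collar neck -/

section Collar

variable {E : Type*} [NormedAddCommGroup E] [InnerProductSpace ℝ E]
  {P : Type*} [TopologicalSpace P] [ChartedSpace E P]

/-- **A ball piece with a collar chart from the other side.** A smooth embedding `ι : E ↪ P`
(the ball piece is `X = ι (B(0,1))`), an open partial diffeomorphism `c : E ⇀ P` defined on the
shell `{1 - δ < ‖y‖ < 1 + ε}` (`0 < δ < 1`, `0 < ε`), such that `c` and `ι` have the same unit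
sphere, the inner part `c {1 - δ < ‖y‖ < 1}` of the collar lies in `X`, and the outer part
`c {1 ≤ ‖y‖ < 1 + ε}` misses `X`. In Hamilton's programme: `ι` the chart of a ball piece of
`M_k ∖ N_k`, `c` the chart of the corresponding surgery ball of `M_{k+1}` pulled back to `M_k`
(Chen–Zhu 2006, Thm. 1.1 (ii)–(iii)). [cite: ChenZhu2006, Thm. 1.1 (iii) (p. 3)] -/
structure BallCollarData (E : Type*) [NormedAddCommGroup E] [InnerProductSpace ℝ E] (n : ℕ)
    [Fact (finrank ℝ E = n + 1)] (P : Type*) [TopologicalSpace P] [ChartedSpace E P] where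
  /-- The chart of the ball piece. -/
  ι : E → P
  /-- The collar chart. -/
  c : OpenPartialHomeomorph E P
  /-- The outer width of the collar. -/
  ε : ℝ
  /-- The inner width of the collar. -/
  δ : ℝ
  ε_pos : 0 < ε
  δ_pos : 0 < δ
  δ_lt_one : δ < 1
  /-- The chart of the ball piece is a smooth embedding. -/
  isSmoothEmbedding_ι : Manifold.IsSmoothEmbedding 𝓘(ℝ, E) 𝓘(ℝ, E) ∞ ι
  /-- The chart of the ball piece has open range. -/
  isOpen_range_ι : IsOpen (range ι)
  /-- The collar chart is smooth on its source. -/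
  contMDiffOn_c : ContMDiffOn 𝓘(ℝ, E) 𝓘(ℝ, E) ∞ c c.source
  /-- The inverse collar chart is smooth on its source. -/
  contMDiffOn_c_symm : ContMDiffOn 𝓘(ℝ, E) 𝓘(ℝ, E) ∞ c.symm c.target
  /-- The collar chart is defined on the shell. -/
  shell_subset : {y : E | 1 - δ < ‖y‖ ∧ ‖y‖ < 1 + ε} ⊆ c.source
  /-- The two charts have the same unit sphere. -/
  image_sphere : c '' sphere 0 1 = ι '' sphere 0 1
  /-- The inner collar lies in the ball piece. -/
  image_inner_subset : c '' {y : E | 1 - δ < ‖y‖ ∧ ‖y‖ < 1} ⊆ ι '' ball 0 1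
  /-- The outer collar misses the ball piece. -/
  disjoint_outer : Disjoint (c '' {y : E | 1 ≤ ‖y‖ ∧ ‖y‖ < 1 + ε}) (ι '' ball 0 1)

namespace BallCollarData

variable {n : ℕ} [Fact (finrank ℝ E = n + 1)] (B : BallCollarData E n P)

/-- Points of the shell are in the source of the collar chart. [folklore] -/
theorem mem_source {y : E} (h1 : 1 - B.δ < ‖y‖) (h2 : ‖y‖ < 1 + B.ε) : y ∈ B.c.source :=
  B.shell_subset ⟨h1, h2⟩

/-- Points `u • θ`, `1 - δ < u < 1 + ε`, are in the source of the collar chart. [folklore] -/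
theorem smul_mem_source (θ : sphere (0 : E) 1) {u : ℝ} (h1 : 1 - B.δ < u) (h2 : u < 1 + B.ε) :
    u • (θ : E) ∈ B.c.source := by
  have hu : 0 < u := by linarith [B.δ_lt_one]
  apply B.mem_source <;> rw [norm_smul, norm_eq_of_mem_sphere, mul_one, Real.norm_of_nonneg hu.le]
  exacts [h1, h2]

/-- The collar chart is injective on its source. [folklore] -/
theorem injOn_c : InjOn B.c B.c.source := B.c.injOn

/-- `‖u • θ‖ = u` for `u > 0`. [folklore] -/
theorem norm_smul_sphere (θ : sphere (0 : E) 1) {u : ℝ} (hu : 0 < u) : ‖u • (θ : E)‖ = u := by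
  rw [norm_smul, norm_eq_of_mem_sphere, mul_one, Real.norm_of_nonneg hu.le]

/-! #### The neck -/

/-- **The collar neck** `ψ (θ, τ) = c ((1 + ε ρ τ) • θ)`. [cite: Hamilton1997, §1.1 pp. 3–4] -/
def neck (q : sphere (0 : E) 1 × ℝ) : P := B.c (collarRad B.ε q.2 • (q.1 : E))

/-- Unfolding the neck. [folklore] -/
theorem neck_apply (θ : sphere (0 : E) 1) (τ : ℝ) : B.neck (θ, τ) = B.c (collarRad B.ε τ • (θ : E)) := rfl

/-- The flipped collar neck `ψ⁻ (θ, τ) = ψ (θ, -τ)`. [folklore] -/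
abbrev neckFlip (q : sphere (0 : E) 1 × ℝ) : P := B.neck (q.1, -q.2)

/-- Unfolding the flipped neck. [folklore] -/
theorem neckFlip_apply (θ : sphere (0 : E) 1) (τ : ℝ) :
    B.neckFlip (θ, τ) = B.c (collarRad B.ε (-τ) • (θ : E)) := rfl

/-- The flipped neck is, as a function, `fun q => ψ (q.1, -q.2)`. [folklore] -/
theorem neckFlip_eq : B.neckFlip = fun q : sphere (0 : E) 1 × ℝ => B.neck (q.1, -q.2) := rfl

/-- The radial argument of the neck lies in the source of the collar chart. [folklore] -/
theorem neck_arg_mem_source (θ : sphere (0 : E) 1) (τ : ℝ) : collarRad B.ε τ • (θ : E) ∈ B.c.source :=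
  B.smul_mem_source θ (by linarith [one_lt_collarRad B.ε_pos τ, B.δ_pos]) (collarRad_lt B.ε_pos τ)

/-- The inverse of the neck: `p ↦ (y/‖y‖, r⁻¹ ‖y‖)`, `y = c⁻¹ p`. [folklore] -/
def neckInv (p : P) : sphere (0 : E) 1 × ℝ :=
  (unitDir (unitSpherePoint n) (B.c.symm p), collarRadInv B.ε ‖B.c.symm p‖)

/-- `neckInv (neck q) = q`. [folklore] -/
theorem neckInv_neck (q : sphere (0 : E) 1 × ℝ) : B.neckInv (B.neck q) = q := by
  obtain ⟨θ, τ⟩ := q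
  have hr := collarRad_pos B.ε_pos τ
  simp only [neckInv, neck_apply, B.c.left_inv (B.neck_arg_mem_source θ τ)]
  rw [unitDir_smul _ θ hr, norm_smul_sphere θ hr, collarRadInv_collarRad B.ε_pos]

/-- The neck is injective. [folklore] -/
theorem injective_neck : Injective B.neck := fun q q' h => by
  rw [← B.neckInv_neck q, ← B.neckInv_neck q', h]

/-- **The range of the neck** is the open collar `c {1 < ‖y‖ < 1 + ε}`. [folklore] -/
theorem range_neck : range B.neck = B.c '' {y : E | 1 < ‖y‖ ∧ ‖y‖ < 1 + B.ε} := by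
  apply Subset.antisymm
  · rintro _ ⟨⟨θ, τ⟩, rfl⟩
    refine ⟨_, ?_, rfl⟩
    rw [mem_setOf_eq, norm_smul_sphere θ (collarRad_pos B.ε_pos τ)]
    exact ⟨one_lt_collarRad B.ε_pos τ, collarRad_lt B.ε_pos τ⟩
  · rintro _ ⟨y, ⟨hy1, hy2⟩, rfl⟩
    have hy0 : y ≠ 0 := by rintro rfl; rw [norm_zero] at hy1; linarith
    refine ⟨(unitDir (unitSpherePoint n) y, collarRadInv B.ε ‖y‖), ?_⟩
    rw [neck_apply, collarRad_collarRadInv B.ε_pos ⟨hy1, hy2⟩, norm_smul_coe_unitDir _ hy0]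

/-- The open collar lies in the source of the collar chart. [folklore] -/
theorem collar_subset_source : {y : E | 1 < ‖y‖ ∧ ‖y‖ < 1 + B.ε} ⊆ B.c.source :=
  fun _ hy => B.mem_source (by linarith [hy.1, B.δ_pos]) hy.2

/-- The open collar is open. [folklore] -/
theorem isOpen_collar : IsOpen {y : E | 1 < ‖y‖ ∧ ‖y‖ < 1 + B.ε} :=
  (isOpen_lt continuous_const continuous_norm).inter (isOpen_lt continuous_norm continuous_const)

/-- The range of the neck is open. [folklore] -/
theorem isOpen_range_neck : IsOpen (range B.neck) := by
  rw [range_neck]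
  exact B.c.isOpen_image_of_subset_source B.isOpen_collar B.collar_subset_source

/-- The range of the neck lies in the target of the collar chart. [folklore] -/
theorem range_neck_subset_target : range B.neck ⊆ B.c.target := by
  rintro _ ⟨⟨θ, τ⟩, rfl⟩
  exact B.c.map_source (B.neck_arg_mem_source θ τ)

/-- The neck is smooth. [folklore] -/
theorem contMDiff_neck : ContMDiff ((𝓡 n).prod 𝓘(ℝ, ℝ)) 𝓘(ℝ, E) ∞ B.neck := by
  have h1 : ContMDiff ((𝓡 n).prod 𝓘(ℝ, ℝ)) 𝓘(ℝ, E) ∞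
      (fun q : sphere (0 : E) 1 × ℝ => collarRad B.ε q.2 • (q.1 : E)) :=
    ((contMDiff_iff_contDiff.2 (contDiff_collarRad B.ε)).comp contMDiff_snd).smul
      (contMDiff_coe_sphere.comp contMDiff_fst)
  exact B.contMDiffOn_c.comp_contMDiff h1 fun q => B.neck_arg_mem_source q.1 q.2

/-- The neck is continuous. [folklore] -/
theorem continuous_neck : Continuous B.neck := B.contMDiff_neck.continuous

/-- The inverse of the neck is smooth on the range of the neck. [folklore] -/
theorem contMDiffOn_neckInv : ContMDiffOn 𝓘(ℝ, E) ((𝓡 n).prod 𝓘(ℝ, ℝ)) ∞ B.neckInv (range B.neck) := by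
  have hF : ContMDiffOn 𝓘(ℝ, E) ((𝓡 n).prod 𝓘(ℝ, ℝ)) ∞
      (fun y : E => (unitDir (unitSpherePoint n) y, collarRadInv B.ε ‖y‖))
      {y : E | 1 < ‖y‖ ∧ ‖y‖ < 1 + B.ε} := by
    refine ((contMDiffOn_unitDir (unitSpherePoint n)).mono ?_).prodMk ?_
    · intro y hy h0
      rw [mem_singleton_iff] at h0
      rw [h0, mem_setOf_eq, norm_zero] at hy
      linarith [hy.1]
    · rw [contMDiffOn_iff_contDiffOn]
      rintro y ⟨hy1, hy2⟩
      have hy0 : y ≠ 0 := by rintro rfl; rw [norm_zero] at hy1; linarith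
      exact ((contDiffAt_collarRadInv B.ε_pos ⟨hy1, hy2⟩).comp y (contDiffAt_norm ℝ hy0)).contDiffWithinAt
  have hG : ContMDiffOn 𝓘(ℝ, E) 𝓘(ℝ, E) ∞ B.c.symm (range B.neck) :=
    B.contMDiffOn_c_symm.mono B.range_neck_subset_target
  refine hF.comp hG ?_
  rintro _ ⟨⟨θ, τ⟩, rfl⟩
  rw [mem_preimage, neck_apply, B.c.left_inv (B.neck_arg_mem_source θ τ), mem_setOf_eq,
    norm_smul_sphere θ (collarRad_pos B.ε_pos τ)]
  exact ⟨one_lt_collarRad B.ε_pos τ, collarRad_lt B.ε_pos τ⟩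

/-- The neck as an open partial homeomorphism `𝕊ⁿ × ℝ ≅ range ψ`. [folklore] -/
def neckPH : OpenPartialHomeomorph (sphere (0 : E) 1 × ℝ) P where
  toFun := B.neck
  invFun := B.neckInv
  source := univ
  target := range B.neck
  map_source' q _ := mem_range_self q
  map_target' _ _ := mem_univ _
  left_inv' q _ := B.neckInv_neck q
  right_inv' := by rintro _ ⟨q, rfl⟩; rw [B.neckInv_neck]
  open_source := isOpen_univ
  open_target := B.isOpen_range_neck
  continuousOn_toFun := B.continuous_neck.continuousOn
  continuousOn_invFun := B.contMDiffOn_neckInv.continuousOn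

/-- **The collar neck is a smooth embedding.** [folklore] -/
theorem isSmoothEmbedding_neck [IsManifold 𝓘(ℝ, E) ∞ P] :
    Manifold.IsSmoothEmbedding ((𝓡 n).prod 𝓘(ℝ, ℝ)) 𝓘(ℝ, E) ∞ B.neck := by
  haveI : FiniteDimensional ℝ E := .of_fact_finrank_eq_succ (K := ℝ) (V := E) n
  have hdim : finrank ℝ (EuclideanSpace ℝ (Fin n) × ℝ) = finrank ℝ E := by
    rw [Module.finrank_prod, finrank_euclideanSpace_fin, Module.finrank_self]
    exact (Fact.out : finrank ℝ E = n + 1).symm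
  exact isSmoothEmbedding_of_openPartialHomeomorph (I := (𝓡 n).prod 𝓘(ℝ, ℝ)) (J := 𝓘(ℝ, E))
    B.neckPH rfl B.contMDiff_neck.contMDiffOn B.contMDiffOn_neckInv
    (ContinuousLinearEquiv.ofFinrankEq hdim)

/-- The flipped collar neck is a smooth embedding. [folklore] -/
theorem isSmoothEmbedding_neckFlip [IsManifold 𝓘(ℝ, E) ∞ P] :
    Manifold.IsSmoothEmbedding ((𝓡 n).prod 𝓘(ℝ, ℝ)) 𝓘(ℝ, E) ∞ B.neckFlip :=
  isSmoothEmbedding_neck_flip B.isSmoothEmbedding_neck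

/-- The flipped collar neck has the same (open) range. [folklore] -/
theorem range_neckFlip : range B.neckFlip = range B.neck := range_neck_flip B.neck

/-! ### §3 The two sides -/

/-- **The near side** `Y = X ∪ c {1 ≤ ‖y‖ < 1 + ε/2}`: the ball piece with the half-collar up to
the middle sphere of the neck. [folklore] -/
def nearSet : Set P := B.ι '' ball 0 1 ∪ B.c '' {y : E | 1 ≤ ‖y‖ ∧ ‖y‖ < collarRad B.ε 0}

/-- The middle sphere `c (𝕊_{1+ε/2}) = ψ (𝕊ⁿ × {0})`. [folklore] -/
def midSphere : Set P := B.c '' sphere 0 (collarRad B.ε 0)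

/-- The middle sphere is the image of the central slice of the neck. [folklore] -/
theorem midSphere_eq : B.midSphere = B.neck '' (univ ×ˢ {0}) := by
  apply Subset.antisymm
  · rintro _ ⟨y, hy, rfl⟩
    rw [mem_sphere_zero_iff_norm] at hy
    have hy0 : y ≠ 0 := by
      rintro rfl; rw [norm_zero] at hy; linarith [collarRad_pos B.ε_pos 0]
    refine ⟨(unitDir (unitSpherePoint n) y, 0), ⟨mem_univ _, rfl⟩, ?_⟩
    rw [neck_apply, ← hy, norm_smul_coe_unitDir _ hy0]
  · rintro _ ⟨⟨θ, t⟩, ⟨-, ht⟩, rfl⟩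
    rw [mem_singleton_iff] at ht
    subst ht
    exact ⟨_, by rw [mem_sphere_zero_iff_norm, norm_smul_sphere θ (collarRad_pos B.ε_pos 0)], rfl⟩

/-- The same for the flipped neck. [folklore] -/
theorem midSphere_eq_flip : B.midSphere = B.neckFlip '' (univ ×ˢ {0}) := by
  rw [midSphere_eq]
  apply Subset.antisymm
  · rintro _ ⟨⟨θ, t⟩, ⟨-, ht⟩, rfl⟩
    rw [mem_singleton_iff] at ht; subst ht
    exact ⟨(θ, 0), ⟨mem_univ _, rfl⟩, by rw [neckFlip_apply, neg_zero, neck_apply]⟩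
  · rintro _ ⟨⟨θ, t⟩, ⟨-, ht⟩, rfl⟩
    rw [mem_singleton_iff] at ht; subst ht
    exact ⟨(θ, 0), ⟨mem_univ _, rfl⟩, by rw [neckFlip_apply, neg_zero, neck_apply]⟩

/-- The inner collar shell `{1 - δ < ‖y‖ < r 0}` lies in the source. [folklore] -/
theorem innerShell_subset_source : {y : E | 1 - B.δ < ‖y‖ ∧ ‖y‖ < collarRad B.ε 0} ⊆ B.c.source :=
  fun _ hy => B.mem_source hy.1 (hy.2.trans (collarRad_lt B.ε_pos 0))

/-- **The near side is open**: by `image_inner_subset` it equals `X ∪ c {1 - δ < ‖y‖ < r 0}`.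
[folklore] -/
theorem nearSet_eq : B.nearSet = B.ι '' ball 0 1 ∪ B.c '' {y : E | 1 - B.δ < ‖y‖ ∧ ‖y‖ < collarRad B.ε 0} := by
  apply Subset.antisymm
  · rintro p (hp | ⟨y, ⟨hy1, hy2⟩, rfl⟩)
    · exact Or.inl hp
    · exact Or.inr ⟨y, ⟨by linarith [B.δ_pos], hy2⟩, rfl⟩
  · rintro p (hp | ⟨y, ⟨hy1, hy2⟩, rfl⟩)
    · exact Or.inl hp
    · rcases lt_or_ge ‖y‖ 1 with h | h
      · exact Or.inl (B.image_inner_subset ⟨y, ⟨hy1, h⟩, rfl⟩)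
      · exact Or.inr ⟨y, ⟨h, hy2⟩, rfl⟩

/-- The chart of the ball piece is an open embedding. [folklore] -/
theorem isOpenEmbedding_ι : IsOpenEmbedding B.ι := ⟨B.isSmoothEmbedding_ι.isEmbedding, B.isOpen_range_ι⟩

/-- The ball piece is open. [folklore] -/
theorem isOpen_image_ball : IsOpen (B.ι '' ball 0 1) := B.isOpenEmbedding_ι.isOpenMap _ isOpen_ball

/-- The near side is open. [folklore] -/
theorem isOpen_nearSet : IsOpen B.nearSet := by
  rw [nearSet_eq]
  refine B.isOpen_image_ball.union (B.c.isOpen_image_of_subset_source ?_ B.innerShell_subset_source)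
  exact (isOpen_lt continuous_const continuous_norm).inter (isOpen_lt continuous_norm continuous_const)

/-- The unit sphere of the collar chart lies in the near side. [folklore] -/
theorem image_sphere_subset_nearSet : B.c '' sphere 0 1 ⊆ B.nearSet := by
  rintro _ ⟨y, hy, rfl⟩
  rw [mem_sphere_zero_iff_norm] at hy
  exact Or.inr ⟨y, ⟨hy.ge, by rw [hy]; exact one_lt_collarRad B.ε_pos 0⟩, rfl⟩

/-- The closed ball piece lies in the near side. [folklore] -/
theorem image_closedBall_subset_nearSet : B.ι '' closedBall 0 1 ⊆ B.nearSet := by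
  rintro _ ⟨x, hx, rfl⟩
  rcases (mem_closedBall_zero_iff.1 hx).lt_or_eq with h | h
  · exact Or.inl ⟨x, mem_ball_zero_iff.2 h, rfl⟩
  · have : B.ι x ∈ B.c '' sphere 0 1 := by
      rw [B.image_sphere]; exact ⟨x, mem_sphere_zero_iff_norm.2 h, rfl⟩
    exact B.image_sphere_subset_nearSet this

/-- A point `c (u • θ)` of the outer collar, `r 0 ≤ u < 1 + ε`, is not in the near side.
[folklore] -/
theorem smul_not_mem_nearSet (θ : sphere (0 : E) 1) {u : ℝ} (hu1 : collarRad B.ε 0 ≤ u) (hu2 : u < 1 + B.ε) :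
    B.c (u • (θ : E)) ∉ B.nearSet := by
  have hu0 : 1 < u := (one_lt_collarRad B.ε_pos 0).trans_le hu1
  rintro (h | ⟨y, ⟨hy1, hy2⟩, hy⟩)
  · refine Set.disjoint_left.1 B.disjoint_outer ⟨u • (θ : E), ⟨?_, ?_⟩, rfl⟩ h
    · rw [norm_smul_sphere θ (by linarith)]; exact hu0.le
    · rw [norm_smul_sphere θ (by linarith)]; exact hu2
  · have hys : y ∈ B.c.source := B.mem_source (by linarith [B.δ_pos]) (hy2.trans (collarRad_lt B.ε_pos 0))
    have hus : u • (θ : E) ∈ B.c.source := B.smul_mem_source θ (by linarith [B.δ_pos]) hu2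
    have := B.injOn_c hys hus hy
    rw [this, norm_smul_sphere θ (by linarith)] at hy2
    linarith

/-- A point `c (u • θ)`, `1 ≤ u < r 0`, is in the near side. [folklore] -/
theorem smul_mem_nearSet (θ : sphere (0 : E) 1) {u : ℝ} (hu1 : 1 ≤ u) (hu2 : u < collarRad B.ε 0) :
    B.c (u • (θ : E)) ∈ B.nearSet :=
  Or.inr ⟨_, ⟨by rwa [norm_smul_sphere θ (by linarith)], by rwa [norm_smul_sphere θ (by linarith)]⟩, rfl⟩

/-- The middle sphere misses the near side. [folklore] -/
theorem disjoint_midSphere_nearSet : Disjoint B.midSphere B.nearSet := by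
  rw [Set.disjoint_left]
  rintro _ ⟨y, hy, rfl⟩
  rw [mem_sphere_zero_iff_norm] at hy
  have hy0 : y ≠ 0 := by rintro rfl; rw [norm_zero] at hy; linarith [collarRad_pos B.ε_pos 0]
  rw [← norm_smul_coe_unitDir (unitSpherePoint n) hy0, hy]
  exact B.smul_not_mem_nearSet _ le_rfl (collarRad_lt B.ε_pos 0)

/-- **The near side with the middle sphere is the compact set** `ι (B̄(0,1)) ∪ c {1 ≤ ‖y‖ ≤ r 0}`.
[folklore] -/
theorem nearSet_union_midSphere :
    B.nearSet ∪ B.midSphere = B.ι '' closedBall 0 1 ∪ B.c '' {y : E | 1 ≤ ‖y‖ ∧ ‖y‖ ≤ collarRad B.ε 0} := by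
  apply Subset.antisymm
  · rintro p ((⟨x, hx, rfl⟩ | ⟨y, ⟨hy1, hy2⟩, rfl⟩) | ⟨y, hy, rfl⟩)
    · exact Or.inl ⟨x, ball_subset_closedBall hx, rfl⟩
    · exact Or.inr ⟨y, ⟨hy1, hy2.le⟩, rfl⟩
    · rw [mem_sphere_zero_iff_norm] at hy
      exact Or.inr ⟨y, ⟨by rw [hy]; exact (one_lt_collarRad B.ε_pos 0).le, hy.le⟩, rfl⟩
  · rintro p (hp | ⟨y, ⟨hy1, hy2⟩, rfl⟩)
    · exact Or.inl (B.image_closedBall_subset_nearSet hp)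
    · rcases hy2.lt_or_eq with h | h
      · exact Or.inl (Or.inr ⟨y, ⟨hy1, h⟩, rfl⟩)
      · exact Or.inr ⟨y, mem_sphere_zero_iff_norm.2 h, rfl⟩

/-- The near side with the middle sphere is compact. [folklore] -/
theorem isCompact_nearSet_union_midSphere : IsCompact (B.nearSet ∪ B.midSphere) := by
  haveI : FiniteDimensional ℝ E := .of_fact_finrank_eq_succ (K := ℝ) (V := E) n
  rw [nearSet_union_midSphere]
  refine ((isCompact_closedBall 0 1).image B.isSmoothEmbedding_ι.contMDiff.continuous).union ?_
  have hK : IsCompact {y : E | 1 ≤ ‖y‖ ∧ ‖y‖ ≤ collarRad B.ε 0} := by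
    have : {y : E | 1 ≤ ‖y‖ ∧ ‖y‖ ≤ collarRad B.ε 0} = closedBall 0 (collarRad B.ε 0) ∩ {y | 1 ≤ ‖y‖} := by
      ext y; simp only [mem_setOf_eq, mem_inter_iff, mem_closedBall_zero_iff]; tauto
    rw [this]
    exact (isCompact_closedBall _ _).inter_right (isClosed_le continuous_const continuous_norm)
  refine hK.image_of_continuousOn (B.c.continuousOn.mono ?_)
  intro y hy
  exact B.mem_source (by linarith [hy.1, B.δ_pos]) (hy.2.trans_lt (collarRad_lt B.ε_pos 0))

/-- The near side with the middle sphere is closed (`P` Hausdorff). [folklore] -/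
theorem isClosed_nearSet_union_midSphere [T2Space P] : IsClosed (B.nearSet ∪ B.midSphere) :=
  B.isCompact_nearSet_union_midSphere.isClosed

/-- **The far side** `P ∖ (Y ∪ c (𝕊_{r 0}))`. [folklore] -/
def farSet : Set P := (B.nearSet ∪ B.midSphere)ᶜ

/-- The far side is open. [folklore] -/
theorem isOpen_farSet [T2Space P] : IsOpen B.farSet := B.isClosed_nearSet_union_midSphere.isOpen_compl

/-- The far side with the middle sphere is the complement of the near side. [folklore] -/
theorem farSet_union_midSphere : B.farSet ∪ B.midSphere = B.nearSetᶜ := by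
  ext p
  simp only [farSet, mem_union, mem_compl_iff, not_or]
  constructor
  · rintro (⟨h, -⟩ | h)
    · exact h
    · exact fun hp => Set.disjoint_left.1 B.disjoint_midSphere_nearSet h hp
  · intro h
    by_cases hm : p ∈ B.midSphere
    · exact Or.inr hm
    · exact Or.inl ⟨h, hm⟩

/-- A point of the neck with `t > 0` lies in the far side. [folklore] -/
theorem neck_mem_farSet (θ : sphere (0 : E) 1) {t : ℝ} (ht : 0 < t) : B.neck (θ, t) ∈ B.farSet := by
  rw [farSet, mem_compl_iff, mem_union, not_or, neck_apply]
  refine ⟨B.smul_not_mem_nearSet θ ((collarRad_zero_lt_iff B.ε_pos).2 ht).le (collarRad_lt B.ε_pos t), ?_⟩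
  rintro ⟨y, hy, hyeq⟩
  rw [mem_sphere_zero_iff_norm] at hy
  have hys : y ∈ B.c.source :=
    B.mem_source (by rw [hy]; linarith [one_lt_collarRad B.ε_pos 0, B.δ_pos]) (by rw [hy]; exact collarRad_lt B.ε_pos 0)
  have := B.injOn_c hys (B.neck_arg_mem_source θ t) hyeq
  rw [this, norm_smul_sphere θ (collarRad_pos B.ε_pos t)] at hy
  exact (((collarRad_zero_lt_iff B.ε_pos).2 ht).ne') hy

/-- A point of the neck with `t < 0` lies in the near side. [folklore] -/
theorem neck_mem_nearSet (θ : sphere (0 : E) 1) {t : ℝ} (ht : t < 0) : B.neck (θ, t) ∈ B.nearSet :=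
  B.smul_mem_nearSet θ (one_lt_collarRad B.ε_pos t).le ((collarRad_lt_zero_iff B.ε_pos).2 ht)

/-- A point of the middle slice of the neck lies in the middle sphere. [folklore] -/
theorem neck_zero_mem_midSphere (θ : sphere (0 : E) 1) : B.neck (θ, 0) ∈ B.midSphere :=
  ⟨_, by rw [mem_sphere_zero_iff_norm, norm_smul_sphere θ (collarRad_pos B.ε_pos 0)], rfl⟩

/-- **The near side as a side of the flipped neck** (`NeckCapData`). [folklore] -/
def near [T2Space P] [IsManifold 𝓘(ℝ, E) ∞ P] :
    NeckCapData n (fun q : sphere (0 : E) 1 × ℝ => B.neck (q.1, -q.2)) where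
  isSmoothEmbedding := B.isSmoothEmbedding_neckFlip
  isOpen_range := by rw [show (fun q : sphere (0 : E) 1 × ℝ => B.neck (q.1, -q.2)) = B.neckFlip from rfl,
    range_neckFlip]; exact B.isOpen_range_neck
  side := ⟨B.nearSet, B.isOpen_nearSet⟩
  isClosed_side_union := by
    change IsClosed (B.nearSet ∪ B.neckFlip '' (univ ×ˢ {0}))
    rw [← midSphere_eq_flip]
    exact B.isClosed_nearSet_union_midSphere
  image_Ioi_subset := by
    rintro _ ⟨⟨θ, t⟩, ⟨-, ht⟩, rfl⟩
    exact B.neck_mem_nearSet θ (neg_lt_zero.2 ht)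
  not_mem_side := fun θ t ht h => by
    change B.neck (θ, -t) ∈ B.nearSet at h
    rw [neck_apply] at h
    exact B.smul_not_mem_nearSet θ ((strictMono_collarRad B.ε_pos).monotone (neg_nonneg.2 ht))
      (collarRad_lt B.ε_pos _) h

/-- The carrier of the near side. [folklore] -/
@[simp] theorem coe_near_side [T2Space P] [IsManifold 𝓘(ℝ, E) ∞ P] : (B.near.side : Set P) = B.nearSet := rfl

/-- **The far side as a side of the neck** (`NeckCapData`). [folklore] -/
def far [T2Space P] [IsManifold 𝓘(ℝ, E) ∞ P] : NeckCapData n B.neck where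
  isSmoothEmbedding := B.isSmoothEmbedding_neck
  isOpen_range := B.isOpen_range_neck
  side := ⟨B.farSet, B.isOpen_farSet⟩
  isClosed_side_union := by
    change IsClosed (B.farSet ∪ B.neck '' (univ ×ˢ {0}))
    rw [← midSphere_eq, farSet_union_midSphere, isClosed_compl_iff]
    exact B.isOpen_nearSet
  image_Ioi_subset := by
    rintro _ ⟨⟨θ, t⟩, ⟨-, ht⟩, rfl⟩
    exact B.neck_mem_farSet θ ht
  not_mem_side := fun θ t ht h => by
    change B.neck (θ, t) ∈ B.farSet at h
    rw [farSet, mem_compl_iff, mem_union, not_or] at h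
    rcases ht.lt_or_eq with hlt | rfl
    · exact h.1 (B.neck_mem_nearSet θ hlt)
    · exact h.2 (B.neck_zero_mem_midSphere θ)

/-- The carrier of the far side. [folklore] -/
@[simp] theorem coe_far_side [T2Space P] [IsManifold 𝓘(ℝ, E) ∞ P] : (B.far.side : Set P) = B.farSet := rfl

/-- **The two sides are disjoint.** [folklore] -/
theorem disjoint_far_near [T2Space P] [IsManifold 𝓘(ℝ, E) ∞ P] :
    Disjoint (B.far.side : Set P) B.near.side := by
  rw [coe_far_side, coe_near_side, farSet, Set.disjoint_left]
  intro p hp hq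
  exact hp (Or.inl hq)

/-- **The two sides cover `P` off the middle sphere.** [folklore] -/
theorem cover_far_near [T2Space P] [IsManifold 𝓘(ℝ, E) ∞ P] (p : P) (h₁ : p ∉ (B.far.side : Set P))
    (h₂ : p ∉ (B.near.side : Set P)) : ∃ θ : sphere (0 : E) 1, B.neck (θ, 0) = p := by
  rw [coe_far_side, farSet, mem_compl_iff, not_not] at h₁
  rw [coe_near_side] at h₂
  have hm : p ∈ B.midSphere := h₁.resolve_left h₂
  rw [midSphere_eq] at hm
  obtain ⟨⟨θ, t⟩, ⟨-, ht⟩, rfl⟩ := hm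
  rw [mem_singleton_iff] at ht; subst ht
  exact ⟨θ, rfl⟩

end BallCollarData

end Collar

/-! ### §4 The cap profile and the cap disc -/

namespace CollarProfile

section CapProfile

open Real

/-- The cut-off `χ s = smoothTransition (4 s - 1)`: `0` for `s ≤ 1/4`, `1` for `s ≥ 1/2`. [folklore] -/
def capCut (s : ℝ) : ℝ := smoothTransition (4 * s - 1)

/-- `χ s = 0` for `s ≤ 1/4`. [folklore] -/
theorem capCut_of_le {s : ℝ} (h : s ≤ 1 / 4) : capCut s = 0 :=
  smoothTransition.zero_of_nonpos (by linarith)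

/-- `χ s = 1` for `s ≥ 1/2`. [folklore] -/
theorem capCut_of_ge {s : ℝ} (h : 1 / 2 ≤ s) : capCut s = 1 :=
  smoothTransition.one_of_one_le (by linarith)

/-- `0 ≤ χ`. [folklore] -/
theorem capCut_nonneg (s : ℝ) : 0 ≤ capCut s := smoothTransition.nonneg _

/-- `χ ≤ 1`. [folklore] -/
theorem capCut_le_one (s : ℝ) : capCut s ≤ 1 := smoothTransition.le_one _

/-- `χ` is smooth. [folklore] -/
theorem contDiff_capCut : ContDiff ℝ ∞ capCut :=
  smoothTransition.contDiff.comp ((contDiff_const.mul contDiff_id).sub contDiff_const)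

/-- The derivative of `χ` is `4 χ₀' (4 s - 1) ≥ 0`. [folklore] -/
theorem hasDerivAt_capCut (s : ℝ) : HasDerivAt capCut (deriv smoothTransition (4 * s - 1) * 4) s := by
  have hd : Differentiable ℝ smoothTransition :=
    (smoothTransition.contDiff (n := 1)).differentiable one_ne_zero
  have h := (hd (4 * s - 1)).hasDerivAt.comp s (((hasDerivAt_id s).const_mul (4 : ℝ)).sub_const 1)
  rw [mul_one] at h
  exact h

/-- **The cap profile** `g s = (1 - χ s) s + χ s (1 - s)⁻¹`: `g s = s` for `s ≤ 1/4`,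
`g s = (1 - s)⁻¹` for `s ≥ 1/2`; on `[0, 1)` it is a strictly increasing smooth bijection onto
`[0, ∞)`. [folklore] -/
def capProfile (s : ℝ) : ℝ := (1 - capCut s) * s + capCut s * (1 - s)⁻¹

/-- `g s = s` for `s ≤ 1/4`. [folklore] -/
theorem capProfile_of_le {s : ℝ} (h : s ≤ 1 / 4) : capProfile s = s := by
  rw [capProfile, capCut_of_le h]; ring

/-- `g s = (1 - s)⁻¹` for `s ≥ 1/2`. [folklore] -/
theorem capProfile_of_ge {s : ℝ} (h : 1 / 2 ≤ s) : capProfile s = (1 - s)⁻¹ := by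
  rw [capProfile, capCut_of_ge h]; ring

/-- `g 0 = 0`. [folklore] -/
theorem capProfile_zero : capProfile 0 = 0 := capProfile_of_le (by norm_num)

/-- The second branch dominates the first: `s < (1 - s)⁻¹` for `s < 1`. [folklore] -/
theorem lt_inv_one_sub {s : ℝ} (hs : s < 1) : s < (1 - s)⁻¹ := by
  have h1 : 0 < 1 - s := by linarith
  rcases le_or_gt s 0 with h | h
  · exact h.trans_lt (inv_pos.2 h1)
  · rw [lt_inv_comm₀ h h1]
    have : s * (1 - s) < 1 := by nlinarith
    calc 1 - s < 1 := by linarith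
      _ ≤ s⁻¹ := by rw [le_inv_comm₀ one_pos h, inv_one]; exact hs.le

/-- `0 < g s` for `0 < s < 1`, indeed `s ≤ g s`. [folklore] -/
theorem le_capProfile {s : ℝ} (hs : s < 1) : s ≤ capProfile s := by
  rw [capProfile]
  have := lt_inv_one_sub hs
  nlinarith [capCut_nonneg s, capCut_le_one s]

/-- `g s` is positive for `0 < s < 1`. [folklore] -/
theorem capProfile_pos {s : ℝ} (h0 : 0 < s) (hs : s < 1) : 0 < capProfile s := h0.trans_le (le_capProfile hs)

/-- `g` is smooth at every `s < 1`. [folklore] -/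
theorem contDiffAt_capProfile {s : ℝ} (hs : s < 1) : ContDiffAt ℝ ∞ capProfile s := by
  have h1 : ContDiffAt ℝ ∞ (fun s : ℝ => (1 - s)⁻¹) s :=
    (contDiffAt_const.sub contDiffAt_id).inv (by simp; linarith)
  unfold capProfile
  exact ((contDiffAt_const.sub contDiff_capCut.contDiffAt).mul contDiffAt_id).add
    (contDiff_capCut.contDiffAt.mul h1)

/-- `g` is continuous on `(-∞, 1)`. [folklore] -/
theorem continuousOn_capProfile : ContinuousOn capProfile (Iio 1) := fun _ hs =>
  (contDiffAt_capProfile hs).continuousAt.continuousWithinAt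

/-- **The derivative of `g`** at `s < 1`:
`g' s = (1 - χ s) + χ s (1 - s)⁻² + 4 χ₀'(4s-1) ((1 - s)⁻¹ - s)`. [folklore] -/
theorem hasDerivAt_capProfile {s : ℝ} (hs : s < 1) :
    HasDerivAt capProfile ((1 - capCut s) + capCut s * ((1 - s) ^ 2)⁻¹ +
      deriv smoothTransition (4 * s - 1) * 4 * ((1 - s)⁻¹ - s)) s := by
  have h1s : (1 - s) ≠ 0 := by linarith
  have hχ := hasDerivAt_capCut s
  have hinv : HasDerivAt (fun s : ℝ => (1 - s)⁻¹) (((1 - s) ^ 2)⁻¹) s := by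
    have h := (hasDerivAt_inv h1s).comp s ((hasDerivAt_const s (1 : ℝ)).sub (hasDerivAt_id s))
    refine h.congr_deriv ?_
    ring
  have hA : HasDerivAt (fun s : ℝ => (1 - capCut s) * s)
      ((0 - deriv smoothTransition (4 * s - 1) * 4) * s + (1 - capCut s) * 1) s :=
    ((hasDerivAt_const s (1 : ℝ)).sub hχ).mul (hasDerivAt_id s)
  have hB : HasDerivAt (fun s : ℝ => capCut s * (1 - s)⁻¹)
      (deriv smoothTransition (4 * s - 1) * 4 * (1 - s)⁻¹ + capCut s * ((1 - s) ^ 2)⁻¹) s :=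
    hχ.mul hinv
  exact (hA.add hB).congr_deriv (by ring)

/-- `g' > 0` on `(-∞, 1)`. [folklore] -/
theorem deriv_capProfile_pos {s : ℝ} (hs : s < 1) : 0 < deriv capProfile s := by
  rw [(hasDerivAt_capProfile hs).deriv]
  have hχ0 := capCut_nonneg s
  have hχ1 := capCut_le_one s
  have hd : 0 ≤ deriv smoothTransition (4 * s - 1) := deriv_smoothTransition_nonneg _
  have hgap : 0 ≤ (1 - s)⁻¹ - s := (sub_pos.2 (lt_inv_one_sub hs)).le
  have hsq : 0 < ((1 - s) ^ 2)⁻¹ := by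
    have : 0 < 1 - s := by linarith
    positivity
  have hblend : 0 < (1 - capCut s) + capCut s * ((1 - s) ^ 2)⁻¹ := by
    rcases hχ1.lt_or_eq with hlt | heq
    · exact add_pos_of_pos_of_nonneg (by linarith) (mul_nonneg hχ0 hsq.le)
    · rw [heq]; linarith
  nlinarith [mul_nonneg (mul_nonneg hd (by norm_num : (0 : ℝ) ≤ 4)) hgap]

/-- `g` is strictly increasing on `(-∞, 1)`. [folklore] -/
theorem strictMonoOn_capProfile : StrictMonoOn capProfile (Iio 1) :=
  strictMonoOn_of_deriv_pos (convex_Iio 1) continuousOn_capProfile fun s hs => by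
    rw [interior_Iio] at hs
    exact deriv_capProfile_pos hs

/-- `g` is injective on `(-∞, 1)`. [folklore] -/
theorem injOn_capProfile : InjOn capProfile (Iio 1) := strictMonoOn_capProfile.injOn

/-- `18 ≤ g s` for `17/18 ≤ s < 1`. [folklore] -/
theorem capProfile_ge_of_ge {s : ℝ} (h : 17 / 18 ≤ s) (hs : s < 1) : 18 ≤ capProfile s := by
  rw [capProfile_of_ge (by linarith)]
  rw [le_inv_comm₀ (by norm_num) (by linarith)]
  linarith

/-- For `17/18 ≤ s < 1`, `4 / g s = 4 (1 - s)`. [folklore] -/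
theorem four_div_capProfile {s : ℝ} (h : 17 / 18 ≤ s) : 4 / capProfile s = 4 * (1 - s) := by
  rw [capProfile_of_ge (by linarith), div_inv_eq_mul]

/-- **`g` maps `[0, 1)` onto `[0, ∞)`.** [folklore] -/
theorem exists_capProfile_eq {t : ℝ} (ht : 0 ≤ t) : ∃ s, 0 ≤ s ∧ s < 1 ∧ capProfile s = t := by
  set s₁ : ℝ := 1 - (t + 2)⁻¹ with hs₁
  have ht2 : 0 < t + 2 := by linarith
  have hs₁lt : s₁ < 1 := by rw [hs₁]; linarith [inv_pos.2 ht2]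
  have hs₁ge : 1 / 2 ≤ s₁ := by
    rw [hs₁]
    have : (t + 2)⁻¹ ≤ 1 / 2 := by rw [inv_le_comm₀ ht2 (by norm_num)]; linarith
    linarith
  have hgs₁ : capProfile s₁ = t + 2 := by
    rw [capProfile_of_ge hs₁ge, hs₁, sub_sub_cancel, inv_inv]
  have hc : ContinuousOn capProfile (Icc 0 s₁) := continuousOn_capProfile.mono fun x hx => hx.2.trans_lt hs₁lt
  have hmem : t ∈ Icc (capProfile 0) (capProfile s₁) := by
    rw [capProfile_zero, hgs₁]; exact ⟨ht, by linarith⟩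
  obtain ⟨s, hs, hst⟩ := intermediate_value_Icc (by linarith : (0 : ℝ) ≤ s₁) hc hmem
  exact ⟨s, hs.1, hs.2.trans_lt hs₁lt, hst⟩

/-- The inverse cap profile (inverse of `g` restricted to `(-∞, 1)`). [folklore] -/
def capProfileInv : ℝ → ℝ := invFunOn capProfile (Iio 1)

/-- `g⁻¹ (g s) = s` for `s < 1`. [folklore] -/
theorem capProfileInv_capProfile {s : ℝ} (hs : s < 1) : capProfileInv (capProfile s) = s :=
  injOn_capProfile.leftInvOn_invFunOn hs

/-- `g⁻¹` is smooth at `g s`, `s < 1`. [folklore] -/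
theorem contDiffAt_capProfileInv {s : ℝ} (hs : s < 1) : ContDiffAt ℝ ∞ capProfileInv (capProfile s) :=
  contDiffAt_of_eventually_leftInverse (contDiffAt_capProfile hs) (hasDerivAt_capProfile hs)
    (by rw [← (hasDerivAt_capProfile hs).deriv]; exact (deriv_capProfile_pos hs).ne') (by simp)
    (Filter.eventually_of_mem (Iio_mem_nhds hs) fun _ hu => capProfileInv_capProfile hu)

end CapProfile

section CapDisc

variable {E : Type*} [NormedAddCommGroup E] [InnerProductSpace ℝ E]

/-- **The cap disc map** `G = radialMap g`: `s θ ↦ g s • θ`, a diffeomorphism of the open unit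
ball onto `E`, the identity near `0`. [folklore] -/
def capDisc : E → E := radialMap capProfile

/-- The inverse cap disc map (on `E`). [folklore] -/
def capDiscInv : E → E := radialMap capProfileInv

/-- `G 0 = 0`. [folklore] -/
theorem capDisc_zero : capDisc (0 : E) = 0 := radialMap_zero _

/-- `G z = z` for `‖z‖ < 1/4`. [folklore] -/
theorem capDisc_eq_self {z : E} (hz : ‖z‖ < 1 / 4) : capDisc z = z :=
  radialMap_eq_self _ (capProfile_of_le hz.le)

/-- `G (s • θ) = g s • θ`. [folklore] -/
theorem capDisc_smul {u : E} (hu : ‖u‖ = 1) {s : ℝ} (hs : 0 < s) : capDisc (s • u) = capProfile s • u :=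
  radialMap_smul _ hu hs

/-- `‖G z‖ = g ‖z‖` for `‖z‖ < 1`. [folklore] -/
theorem norm_capDisc {z : E} (hz : ‖z‖ < 1) : ‖capDisc z‖ = capProfile ‖z‖ := by
  rcases eq_or_ne z 0 with rfl | h0
  · rw [capDisc_zero, norm_zero, capProfile_zero]
  · rw [capDisc, norm_radialMap _ h0, abs_of_pos (capProfile_pos (norm_pos_iff.2 h0) hz)]

/-- `G` is smooth at the points of the open unit ball. [folklore] -/
theorem contDiffAt_capDisc {z : E} (hz : ‖z‖ < 1) : ContDiffAt ℝ ∞ (capDisc : E → E) z := by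
  rcases eq_or_ne z 0 with rfl | h0
  · have hev : (capDisc : E → E) =ᶠ[𝓝 0] id :=
      Filter.eventuallyEq_of_mem (ball_mem_nhds (0 : E) (by norm_num : (0 : ℝ) < 1 / 4))
        fun w hw => capDisc_eq_self (by simpa using hw)
    exact contDiffAt_id.congr_of_eventuallyEq hev
  · exact contDiffAt_radialMap h0 (contDiffAt_capProfile hz)

/-- `G⁻¹ (G z) = z` on the open unit ball. [folklore] -/
theorem capDiscInv_capDisc {z : E} (hz : ‖z‖ < 1) : capDiscInv (capDisc z) = z := by
  rcases eq_or_ne z 0 with rfl | h0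
  · rw [capDisc_zero, capDiscInv, radialMap_zero]
  · rw [capDiscInv, capDisc, radialMap_radialMap _ _ h0 (capProfile_pos (norm_pos_iff.2 h0) hz),
      capProfileInv_capProfile hz, mul_inv_cancel₀ (norm_ne_zero_iff.2 h0), one_smul]

/-- `G` is injective on the open unit ball. [folklore] -/
theorem injOn_capDisc : InjOn (capDisc : E → E) (ball 0 1) := fun x hx y hy h => by
  rw [mem_ball_zero_iff] at hx hy
  rw [← capDiscInv_capDisc hx, ← capDiscInv_capDisc hy, h]

/-- **`G` maps the open unit ball onto `E`.** [folklore] -/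
theorem exists_capDisc_eq [Nontrivial E] (y : E) : ∃ z : E, ‖z‖ < 1 ∧ capDisc z = y := by
  rcases eq_or_ne y 0 with rfl | hy0
  · exact ⟨0, by simp, capDisc_zero⟩
  · obtain ⟨s, hs0, hs1, hst⟩ := exists_capProfile_eq (norm_nonneg y)
    have hspos : 0 < s := by
      rcases hs0.eq_or_lt with h | h
      · exfalso; rw [← h, capProfile_zero] at hst; exact hy0 (norm_eq_zero.1 hst.symm)
      · exact h
    set u : E := ‖y‖⁻¹ • y with hu
    have hu1 : ‖u‖ = 1 := by rw [hu, norm_smul, norm_inv, norm_norm, inv_mul_cancel₀ (norm_ne_zero_iff.2 hy0)]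
    refine ⟨s • u, by rw [norm_smul, hu1, mul_one, Real.norm_of_nonneg hs0]; exact hs1, ?_⟩
    rw [capDisc_smul hu1 hspos, hst, hu, smul_smul, mul_inv_cancel₀ (norm_ne_zero_iff.2 hy0), one_smul]

/-- `G⁻¹` is smooth at `G z`, `‖z‖ < 1`. [folklore] -/
theorem contDiffAt_capDiscInv {z : E} (hz : ‖z‖ < 1) : ContDiffAt ℝ ∞ (capDiscInv : E → E) (capDisc z) := by
  rcases eq_or_ne z 0 with rfl | h0
  · have hev : (capDiscInv : E → E) =ᶠ[𝓝 (capDisc 0)] id := by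
      rw [capDisc_zero]
      refine Filter.eventuallyEq_of_mem (ball_mem_nhds (0 : E) (by norm_num : (0 : ℝ) < 1 / 4)) fun w hw => ?_
      have hw' : ‖w‖ < 1 / 4 := by simpa using hw
      have : capProfileInv ‖w‖ = ‖w‖ := by
        conv_lhs => rw [← capProfile_of_le hw'.le]
        exact capProfileInv_capProfile (by linarith)
      exact radialMap_eq_self _ this
    exact contDiffAt_id.congr_of_eventuallyEq hev
  · have hGz : capDisc z ≠ 0 := by
      rw [← norm_pos_iff, norm_capDisc hz]; exact capProfile_pos (norm_pos_iff.2 h0) hz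
    refine contDiffAt_radialMap hGz ?_
    rw [norm_capDisc hz]
    exact contDiffAt_capProfileInv hz

/-- **The differential of `G` is injective on the open unit ball** (it has the smooth local left
inverse `G⁻¹`). [folklore] -/
theorem injective_fderiv_capDisc {z : E} (hz : ‖z‖ < 1) : Injective (fderiv ℝ (capDisc : E → E) z) := by
  have hf : HasFDerivAt (capDisc : E → E) (fderiv ℝ capDisc z) z :=
    ((contDiffAt_capDisc hz).differentiableAt (by simp)).hasFDerivAt
  have hg : HasFDerivAt (capDiscInv : E → E) (fderiv ℝ capDiscInv (capDisc z)) (capDisc z) :=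
    ((contDiffAt_capDiscInv hz).differentiableAt (by simp)).hasFDerivAt
  have hcomp := hg.comp z hf
  have hid : HasFDerivAt (capDiscInv ∘ capDisc : E → E) (ContinuousLinearMap.id ℝ E) z := by
    refine (hasFDerivAt_id z).congr_of_eventuallyEq ?_
    exact Filter.eventuallyEq_of_mem (isOpen_ball.mem_nhds (mem_ball_zero_iff.2 hz))
      fun w hw => capDiscInv_capDisc (mem_ball_zero_iff.1 hw)
  have heq := hcomp.unique hid
  intro v w hvw
  have := congrArg (fderiv ℝ capDiscInv (capDisc z)) hvw
  rw [← ContinuousLinearMap.comp_apply, ← ContinuousLinearMap.comp_apply, heq] at this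
  simpa using this

end CapDisc

/-! ### §5 The rim profile -/

section Rim

variable {E : Type*} [NormedAddCommGroup E] [InnerProductSpace ℝ E] {ε : ℝ}

/-- The rim radius `F s = 1 + 4 ε (1 - s)` (affine, decreasing, `F 1 = 1`). [folklore] -/
def rimRad (ε s : ℝ) : ℝ := 1 + 4 * ε * (1 - s)

/-- The inverse rim radius `F⁻¹ u = 1 - (u - 1)/(4 ε)`. [folklore] -/
def rimRadInv (ε u : ℝ) : ℝ := 1 - (u - 1) / (4 * ε)

/-- `F 1 = 1`. [folklore] -/
theorem rimRad_one (ε : ℝ) : rimRad ε 1 = 1 := by simp [rimRad]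

/-- `F⁻¹ (F s) = s`. [folklore] -/
theorem rimRadInv_rimRad (hε : 0 < ε) (s : ℝ) : rimRadInv ε (rimRad ε s) = s := by
  rw [rimRadInv, rimRad]; field_simp; ring

/-- `F` is smooth. [folklore] -/
theorem contDiff_rimRad (ε : ℝ) : ContDiff ℝ ∞ (rimRad ε) :=
  contDiff_const.add (contDiff_const.mul (contDiff_const.sub contDiff_id))

/-- `F⁻¹` is smooth. [folklore] -/
theorem contDiff_rimRadInv (ε : ℝ) : ContDiff ℝ ∞ (rimRadInv ε) :=
  contDiff_const.sub ((contDiff_id.sub contDiff_const).div_const _)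

/-- `F s < 1 ↔ 1 < s`. [folklore] -/
theorem rimRad_lt_one_iff (hε : 0 < ε) {s : ℝ} : rimRad ε s < 1 ↔ 1 < s := by
  rw [rimRad]; constructor <;> intro h <;> nlinarith

/-- `1 - δ < F s` for `s < 1 + δ/(4ε)`. [folklore] -/
theorem lt_rimRad (hε : 0 < ε) {δ s : ℝ} (hs : s < 1 + δ / (4 * ε)) : 1 - δ < rimRad ε s := by
  rw [rimRad]
  have h4 : 0 < 4 * ε := by linarith
  have : 4 * ε * (s - 1) < δ := by
    calc 4 * ε * (s - 1) < 4 * ε * (δ / (4 * ε)) := by apply mul_lt_mul_of_pos_left _ h4; linarith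
      _ = δ := by field_simp
  linarith

/-- `F s < 1 + 2ε/9 (< 1 + ε/2)` for `17/18 < s`. [folklore] -/
theorem rimRad_lt (hε : 0 < ε) {s : ℝ} (hs : 17 / 18 < s) : rimRad ε s < 1 + ε / 2 := by
  rw [rimRad]; nlinarith

/-- **The rim radius matches the neck radius on the overlap**: for `17/18 ≤ s < 1`,
`r (-g s) = F s`. [folklore] -/
theorem collarRad_neg_capProfile {s : ℝ} (h : 17 / 18 ≤ s) (hs : s < 1) :
    collarRad ε (-capProfile s) = rimRad ε s := by
  rw [collarRad_neg_of_ge (capProfile_ge_of_ge h hs), capProfile_of_ge (by linarith), div_inv_eq_mul, rimRad]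

/-- The rim map `s θ ↦ F s • θ`. [folklore] -/
def rimMap (ε : ℝ) : E → E := radialMap (rimRad ε)

/-- The inverse rim map. [folklore] -/
def rimMapInv (ε : ℝ) : E → E := radialMap (rimRadInv ε)

/-- `rimMap (s • u) = F s • u`. [folklore] -/
theorem rimMap_smul {u : E} (hu : ‖u‖ = 1) {s : ℝ} (hs : 0 < s) : rimMap ε (s • u) = rimRad ε s • u :=
  radialMap_smul _ hu hs

/-- `rimMap` fixes the unit sphere. [folklore] -/
theorem rimMap_eq_self_of_norm_eq_one {z : E} (hz : ‖z‖ = 1) : rimMap ε z = z :=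
  radialMap_eq_self _ (by rw [hz, rimRad_one])

/-- `‖rimMap z‖ = F ‖z‖` when `F ‖z‖ > 0` and `z ≠ 0`. [folklore] -/
theorem norm_rimMap {z : E} (hz : z ≠ 0) (hF : 0 < rimRad ε ‖z‖) : ‖rimMap ε z‖ = rimRad ε ‖z‖ := by
  rw [rimMap, norm_radialMap _ hz, abs_of_pos hF]

/-- `rimMap` is smooth away from `0`. [folklore] -/
theorem contDiffAt_rimMap {z : E} (hz : z ≠ 0) : ContDiffAt ℝ ∞ (rimMap ε : E → E) z :=
  contDiffAt_radialMap hz (contDiff_rimRad ε).contDiffAt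

/-- `rimMapInv` is smooth away from `0`. [folklore] -/
theorem contDiffAt_rimMapInv {y : E} (hy : y ≠ 0) : ContDiffAt ℝ ∞ (rimMapInv ε : E → E) y :=
  contDiffAt_radialMap hy (contDiff_rimRadInv ε).contDiffAt

/-- `rimMapInv (rimMap z) = z` when `z ≠ 0` and `F ‖z‖ > 0`. [folklore] -/
theorem rimMapInv_rimMap (hε : 0 < ε) {z : E} (hz : z ≠ 0) (hF : 0 < rimRad ε ‖z‖) : rimMapInv ε (rimMap ε z) = z := by
  rw [rimMapInv, rimMap, radialMap_radialMap _ _ hz hF, rimRadInv_rimRad hε,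
    mul_inv_cancel₀ (norm_ne_zero_iff.2 hz), one_smul]

end Rim

end CollarProfile


/-! ### §6 The capped near side is covered by two ambient discs -/

section TwoDiscs

variable {E : Type*} [NormedAddCommGroup E] [InnerProductSpace ℝ E]
  {P : Type*} [TopologicalSpace P] [ChartedSpace E P]
  {n : ℕ} [Fact (finrank ℝ E = n + 1)] (B : BallCollarData E n P)

namespace BallCollarData

/-! #### Radii and windows (no separation hypotheses needed) -/

/-- The preimage of the near side under the ball chart is an open set containing the closed unit
ball. [folklore] -/
theorem exists_RA : ∃ R : ℝ, 1 < R ∧ ball (0 : E) R ⊆ B.ι ⁻¹' B.nearSet := by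
  haveI : FiniteDimensional ℝ E := .of_fact_finrank_eq_succ (K := ℝ) (V := E) n
  refine exists_ball_subset_of_closedBall_subset (B.isOpen_nearSet.preimage B.isSmoothEmbedding_ι.contMDiff.continuous)
    fun x hx => ?_
  exact B.image_closedBall_subset_nearSet ⟨x, hx, rfl⟩

/-- A radius `R_A > 1` with `ι (B(0, R_A)) ⊆ Y`. [folklore] -/
def RA : ℝ := B.exists_RA.choose

/-- `1 < R_A`. [folklore] -/
theorem one_lt_RA : 1 < B.RA := B.exists_RA.choose_spec.1

/-- `ι (B(0, R_A)) ⊆ Y`. [folklore] -/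
theorem ball_RA_subset : ball (0 : E) B.RA ⊆ B.ι ⁻¹' B.nearSet := B.exists_RA.choose_spec.2

/-- `ι (ballStretch R_A x)` lies in the near side. [folklore] -/
theorem ι_ballStretch_mem (x : E) : B.ι (ballStretch B.RA x) ∈ B.nearSet :=
  B.ball_RA_subset (mem_ball_zero_iff.2 (norm_ballStretch_lt B.one_lt_RA x))

/-- `ι x ∈ Y` for `‖x‖ ≤ 1`. [folklore] -/
theorem ι_mem_nearSet {x : E} (hx : ‖x‖ ≤ 1) : B.ι x ∈ B.nearSet :=
  B.image_closedBall_subset_nearSet ⟨x, mem_closedBall_zero_iff.2 hx, rfl⟩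

/-- `c x ∈ Y` for `‖x‖ = 1`. [folklore] -/
theorem c_mem_nearSet_of_norm_eq_one {x : E} (hx : ‖x‖ = 1) : B.c x ∈ B.nearSet :=
  B.image_sphere_subset_nearSet ⟨x, mem_sphere_zero_iff_norm.2 hx, rfl⟩

/-- The overshoot `η = δ/(4ε)`: `F (1 + η) = 1 - δ`. [folklore] -/
def η : ℝ := B.δ / (4 * B.ε)

/-- `0 < η`. [folklore] -/
theorem η_pos : 0 < B.η := div_pos B.δ_pos (by linarith [B.ε_pos])

/-- The rim window `W = {17/18 < ‖x‖ < 1 + η}`. [folklore] -/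
def rimWindow : Set E := {x | 17 / 18 < ‖x‖ ∧ ‖x‖ < 1 + B.η}

/-- The rim window is open. [folklore] -/
theorem isOpen_rimWindow : IsOpen B.rimWindow :=
  (isOpen_lt continuous_const continuous_norm).inter (isOpen_lt continuous_norm continuous_const)

/-- Points of the rim window are nonzero. [folklore] -/
theorem ne_zero_of_mem_rimWindow {x : E} (hx : x ∈ B.rimWindow) : x ≠ 0 := by
  rintro rfl; rw [rimWindow, mem_setOf_eq, norm_zero] at hx; linarith [hx.1]

/-- A point of the unit sphere is in the rim window. [folklore] -/
theorem mem_rimWindow_of_norm_eq_one {x : E} (hx : ‖x‖ = 1) : x ∈ B.rimWindow :=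
  ⟨by rw [hx]; norm_num, by rw [hx]; linarith [B.η_pos]⟩

/-- A point of `B(0, 1 + η)` is in the unit ball or in the rim window. [folklore] -/
theorem lt_one_or_mem_rimWindow {x : E} (hx : ‖x‖ < 1 + B.η) : ‖x‖ < 1 ∨ x ∈ B.rimWindow := by
  by_cases h : ‖x‖ < 1
  · exact Or.inl h
  · exact Or.inr ⟨by linarith [not_lt.1 h], hx⟩

/-- The rim radius of a point of the window lies in `(1 - δ, r 0)`. [folklore] -/
theorem rimRad_mem {x : E} (hx : x ∈ B.rimWindow) : 1 - B.δ < rimRad B.ε ‖x‖ ∧ rimRad B.ε ‖x‖ < collarRad B.ε 0 := by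
  refine ⟨lt_rimRad B.ε_pos hx.2, ?_⟩
  rw [collarRad_zero]
  exact rimRad_lt B.ε_pos hx.1

/-- The rim radius is positive on the window. [folklore] -/
theorem rimRad_pos {x : E} (hx : x ∈ B.rimWindow) : 0 < rimRad B.ε ‖x‖ := by
  linarith [(B.rimRad_mem hx).1, B.δ_lt_one]

/-- The rim point of a point of the window lies in the source of the collar chart. [folklore] -/
theorem rimMap_mem_source {x : E} (hx : x ∈ B.rimWindow) : rimMap B.ε x ∈ B.c.source := by
  have h0 := B.ne_zero_of_mem_rimWindow hx
  obtain ⟨h1, h2⟩ := B.rimRad_mem hx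
  apply B.mem_source <;> rw [norm_rimMap h0 (B.rimRad_pos hx)]
  · exact h1
  · exact h2.trans (collarRad_lt B.ε_pos 0)

/-- **The rim lies in the near side**: `c (F s • θ) ∈ Y` for `s θ` in the window. [folklore] -/
theorem c_rimMap_mem {x : E} (hx : x ∈ B.rimWindow) : B.c (rimMap B.ε x) ∈ B.nearSet := by
  have h0 := B.ne_zero_of_mem_rimWindow hx
  obtain ⟨h1, h2⟩ := B.rimRad_mem hx
  set θ : sphere (0 : E) 1 := unitDir (unitSpherePoint n) x with hθ
  have hx' : rimMap B.ε x = rimRad B.ε ‖x‖ • (θ : E) := by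
    conv_lhs => rw [← norm_smul_coe_unitDir (unitSpherePoint n) h0]
    rw [rimMap_smul (norm_eq_of_mem_sphere θ) (norm_pos_iff.2 h0)]
  rw [hx']
  rcases le_or_gt 1 (rimRad B.ε ‖x‖) with h | h
  · exact B.smul_mem_nearSet θ h h2
  · refine Or.inl (B.image_inner_subset ⟨_, ⟨?_, ?_⟩, rfl⟩)
    · rwa [norm_smul_sphere θ (B.rimRad_pos hx)]
    · rwa [norm_smul_sphere θ (B.rimRad_pos hx)]

/-- A base point of the near side (on the unit sphere of the collar chart). [folklore] -/
theorem basePoint_mem : B.c ((unitSpherePoint n : sphere (0 : E) 1) : E) ∈ B.nearSet :=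
  B.c_mem_nearSet_of_norm_eq_one (norm_eq_of_mem_sphere _)

/-- The globalising radius `R_B = 1 + η/2`. [folklore] -/
def RB : ℝ := 1 + B.η / 2

/-- `1 < R_B`. [folklore] -/
theorem one_lt_RB : 1 < B.RB := by unfold RB; linarith [B.η_pos]

/-- `R_B < 1 + η`. [folklore] -/
theorem RB_lt : B.RB < 1 + B.η := by unfold RB; linarith [B.η_pos]

variable [T2Space P] [IsManifold 𝓘(ℝ, E) ∞ P]

/-! #### The first disc: the closed ball piece -/

/-- **The first ambient disc** `F_A = inl ∘ ι ∘ ballStretch R_A : E → Ŷ`; on the closed unit ball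
it is `inl ∘ ι`. [folklore] -/
def FA (x : E) : B.near.Capped := B.near.glueData.inl ⟨B.ι (ballStretch B.RA x), B.ι_ballStretch_mem x⟩

/-- `F_A` is a smooth embedding of `E`. [folklore] -/
theorem isSmoothEmbedding_FA : Manifold.IsSmoothEmbedding 𝓘(ℝ, E) 𝓘(ℝ, E) ∞ B.FA :=
  B.near.isSmoothEmbedding_inl_comp (B.isSmoothEmbedding_ι.comp_ballStretch B.one_lt_RA) B.ι_ballStretch_mem

/-- `F_A x = inl (ι x)` on the closed unit ball. [folklore] -/
theorem FA_apply_of_norm_le {x : E} (hx : ‖x‖ ≤ 1) (h : B.ι x ∈ B.nearSet) :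
    B.FA x = B.near.glueData.inl ⟨B.ι x, h⟩ := by
  unfold FA
  congr 2
  exact congrArg B.ι (ballStretch_eq_self B.one_lt_RA hx)

/-! #### The second disc: the cap and the rim -/

open Classical in
/-- **The rim lift** `x ↦ c (rimMap x)` as a map into the near side (junk off the window).
[folklore] -/
def rimLift (x : E) : B.near.side :=
  if hx : x ∈ B.rimWindow then ⟨B.c (rimMap B.ε x), B.c_rimMap_mem hx⟩
  else ⟨B.c ((unitSpherePoint n : sphere (0 : E) 1) : E), B.basePoint_mem⟩

/-- The rim lift on the window. [folklore] -/
theorem coe_rimLift {x : E} (hx : x ∈ B.rimWindow) : (B.rimLift x : P) = B.c (rimMap B.ε x) := by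
  rw [rimLift, dif_pos hx]

/-- The rim lift is smooth on the window, as a map into `P`. [folklore] -/
theorem contMDiffAt_coe_rimLift {x : E} (hx : x ∈ B.rimWindow) :
    ContMDiffAt 𝓘(ℝ, E) 𝓘(ℝ, E) ∞ (fun y => (B.rimLift y : P)) x := by
  have hev : (fun y => (B.rimLift y : P)) =ᶠ[𝓝 x] fun y => B.c (rimMap B.ε y) :=
    Filter.eventuallyEq_of_mem (B.isOpen_rimWindow.mem_nhds hx) fun y hy => B.coe_rimLift hy
  refine ContMDiffAt.congr_of_eventuallyEq ?_ hev
  have h1 : ContMDiffAt 𝓘(ℝ, E) 𝓘(ℝ, E) ∞ (rimMap B.ε : E → E) x :=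
    contMDiffAt_iff_contDiffAt.2 (contDiffAt_rimMap (B.ne_zero_of_mem_rimWindow hx))
  exact (B.contMDiffOn_c.contMDiffAt (B.c.open_source.mem_nhds (B.rimMap_mem_source hx))).comp x h1

/-- The rim lift is smooth on the window. [folklore] -/
theorem contMDiffAt_rimLift {x : E} (hx : x ∈ B.rimWindow) : ContMDiffAt 𝓘(ℝ, E) 𝓘(ℝ, E) ∞ B.rimLift x :=
  (ContMDiffAt.subtypeVal_comp_iff _ _ _).1 (B.contMDiffAt_coe_rimLift hx)

/-- `inl ∘ rimLift` is smooth on the window. [folklore] -/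
theorem contMDiffAt_inl_rimLift {x : E} (hx : x ∈ B.rimWindow) :
    ContMDiffAt 𝓘(ℝ, E) 𝓘(ℝ, E) ∞ (fun y => B.near.glueData.inl (B.rimLift y)) x :=
  B.near.glueData.contMDiff_inl.contMDiffAt.comp x (B.contMDiffAt_rimLift hx)

open Classical in
/-- **The second ambient disc, raw**: `inr (G x)` inside the unit ball, `inl (c (rimMap x))` on the
rim window. [folklore] -/
def FB₀ (x : E) : B.near.Capped := if ‖x‖ < 1 then B.near.glueData.inr (capDisc x) else B.near.glueData.inl (B.rimLift x)

/-- `F_B₀ = inr ∘ G` inside the unit ball. [folklore] -/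
theorem FB₀_of_lt {x : E} (hx : ‖x‖ < 1) : B.FB₀ x = B.near.glueData.inr (capDisc x) := if_pos hx

/-- `F_B₀ = inl ∘ rimLift` off the unit ball. [folklore] -/
theorem FB₀_of_ge {x : E} (hx : 1 ≤ ‖x‖) : B.FB₀ x = B.near.glueData.inl (B.rimLift x) := if_neg (not_lt.2 hx)

/-- **The two formulas agree on the overlap** `17/18 < ‖x‖ < 1`: `inr (g s • θ) = inl (c (F s • θ))`
since `ψ⁻ (θ, g s) = c (r (-g s) • θ) = c (F s • θ)`. [folklore] -/
theorem inr_capDisc_eq_inl_rimLift {x : E} (hx : x ∈ B.rimWindow) (hx1 : ‖x‖ < 1) :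
    B.near.glueData.inr (capDisc x) = B.near.glueData.inl (B.rimLift x) := by
  have h0 := B.ne_zero_of_mem_rimWindow hx
  set θ : sphere (0 : E) 1 := unitDir (unitSpherePoint n) x with hθ
  set s : ℝ := ‖x‖ with hs
  have hspos : 0 < s := norm_pos_iff.2 h0
  have hxθ : x = s • (θ : E) := (norm_smul_coe_unitDir (unitSpherePoint n) h0).symm
  have ht : 0 < capProfile s := capProfile_pos hspos hx1
  have hG : capDisc x = capProfile s • (θ : E) := by rw [hxθ, capDisc_smul (norm_eq_of_mem_sphere θ) hspos]
  have hneck : B.neck (θ, -capProfile s) = B.c (rimMap B.ε x) := by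
    rw [neck_apply, collarRad_neg_capProfile hx.1.le hx1, hxθ, rimMap_smul (norm_eq_of_mem_sphere θ) hspos,
      norm_smul_sphere θ hspos]
  have key := B.near.inl_eq_inr θ ht
  -- `key : inl ⟨ψ⁻ (θ, g s), _⟩ = inr (g s • θ)`
  rw [hG, ← key]
  congr 1
  apply Subtype.ext
  rw [coe_rimLift _ hx]
  exact hneck

/-- `F_B₀ = inl ∘ rimLift` on the whole rim window. [folklore] -/
theorem FB₀_eq_of_mem_rimWindow {x : E} (hx : x ∈ B.rimWindow) : B.FB₀ x = B.near.glueData.inl (B.rimLift x) := by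
  rcases lt_or_ge ‖x‖ 1 with h | h
  · rw [FB₀_of_lt _ h, B.inr_capDisc_eq_inl_rimLift hx h]
  · exact B.FB₀_of_ge h

/-- `F_B₀` is smooth at the points of the open unit ball. [folklore] -/
theorem contMDiffAt_FB₀_of_lt {x : E} (hx : ‖x‖ < 1) : ContMDiffAt 𝓘(ℝ, E) 𝓘(ℝ, E) ∞ B.FB₀ x := by
  have hev : B.FB₀ =ᶠ[𝓝 x] fun y => B.near.glueData.inr (capDisc y) :=
    Filter.eventuallyEq_of_mem (isOpen_ball.mem_nhds (mem_ball_zero_iff.2 hx)) fun y hy =>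
      B.FB₀_of_lt (mem_ball_zero_iff.1 hy)
  refine ContMDiffAt.congr_of_eventuallyEq ?_ hev
  exact B.near.glueData.contMDiff_inr.contMDiffAt.comp x (contMDiffAt_iff_contDiffAt.2 (contDiffAt_capDisc hx))

/-- `F_B₀` is smooth at the points of the rim window. [folklore] -/
theorem contMDiffAt_FB₀_of_mem_rimWindow {x : E} (hx : x ∈ B.rimWindow) : ContMDiffAt 𝓘(ℝ, E) 𝓘(ℝ, E) ∞ B.FB₀ x := by
  have hev : B.FB₀ =ᶠ[𝓝 x] fun y => B.near.glueData.inl (B.rimLift y) :=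
    Filter.eventuallyEq_of_mem (B.isOpen_rimWindow.mem_nhds hx) fun y hy => B.FB₀_eq_of_mem_rimWindow hy
  exact (B.contMDiffAt_inl_rimLift hx).congr_of_eventuallyEq hev

/-- `F_B₀` is smooth on `B(0, 1 + η)`. [folklore] -/
theorem contMDiffAt_FB₀ {x : E} (hx : ‖x‖ < 1 + B.η) : ContMDiffAt 𝓘(ℝ, E) 𝓘(ℝ, E) ∞ B.FB₀ x := by
  rcases B.lt_one_or_mem_rimWindow hx with h | h
  · exact B.contMDiffAt_FB₀_of_lt h
  · exact B.contMDiffAt_FB₀_of_mem_rimWindow h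

/-- **The second ambient disc** `F_B = F_B₀ ∘ ballStretch R_B`; on the closed unit ball it is
`F_B₀`. [folklore] -/
def FB (x : E) : B.near.Capped := B.FB₀ (ballStretch B.RB x)

/-- `F_B = F_B₀` on the closed unit ball. [folklore] -/
theorem FB_apply_of_norm_le {x : E} (hx : ‖x‖ ≤ 1) : B.FB x = B.FB₀ x := by
  rw [FB, ballStretch_eq_self B.one_lt_RB hx]

/-- `F_B` is smooth. [folklore] -/
theorem contMDiff_FB : ContMDiff 𝓘(ℝ, E) 𝓘(ℝ, E) ∞ B.FB := fun x =>
  (B.contMDiffAt_FB₀ ((norm_ballStretch_lt B.one_lt_RB x).trans B.RB_lt)).comp x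
    (contMDiffAt_iff_contDiffAt.2 (contDiff_ballStretch B.one_lt_RB).contDiffAt)

/-! #### Values of the two discs -/

/-- On the unit sphere, `F_B x = inl (c x)`. [folklore] -/
theorem FB_of_norm_eq_one {x : E} (hx : ‖x‖ = 1) :
    B.FB x = B.near.glueData.inl ⟨B.c x, B.c_mem_nearSet_of_norm_eq_one hx⟩ := by
  rw [B.FB_apply_of_norm_le hx.le, B.FB₀_of_ge hx.ge]
  congr 1
  apply Subtype.ext
  rw [B.coe_rimLift (B.mem_rimWindow_of_norm_eq_one hx), rimMap_eq_self_of_norm_eq_one hx]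

/-- Inside the unit ball, `F_B x = inr (G x)`. [folklore] -/
theorem FB_of_norm_lt_one {x : E} (hx : ‖x‖ < 1) : B.FB x = B.near.glueData.inr (capDisc x) := by
  rw [B.FB_apply_of_norm_le hx.le, B.FB₀_of_lt hx]

/-- A point of the side identified with a cap point is a point `c (u • θ)` with `1 < u < 1 + ε`
(a point of the flipped half-neck). [folklore] -/
theorem exists_of_inl_eq_inr {a : B.near.side} {y : E} (h : B.near.glueData.inl a = B.near.glueData.inr y) :
    ∃ (θ : sphere (0 : E) 1) (u : ℝ), 1 < u ∧ u < 1 + B.ε ∧ (a : P) = B.c (u • (θ : E)) := by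
  rw [SmoothGlueData.inl_eq_inr_iff] at h
  obtain ⟨ha, -⟩ := h
  have ha' : (a : P) ∈ B.near.glueP.source := (B.near.mem_glue_source).1 ha
  obtain ⟨θ, t, ht, hta⟩ := (B.near.mem_glueP_source).1 ha'
  refine ⟨θ, collarRad B.ε (-t), one_lt_collarRad B.ε_pos _, collarRad_lt B.ε_pos _, ?_⟩
  rw [← hta]
  rfl

/-- No point `ι a`, `‖a‖ ≤ 1`, of the closed ball piece is a cap point. [folklore] -/
theorem inl_ι_ne_inr {a : E} (ha : ‖a‖ ≤ 1) (hmem : B.ι a ∈ B.nearSet) (y : E) :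
    B.near.glueData.inl ⟨B.ι a, hmem⟩ ≠ B.near.glueData.inr y := by
  intro h
  obtain ⟨θ, u, hu1, hu2, hau⟩ := B.exists_of_inl_eq_inr h
  change B.ι a = B.c (u • (θ : E)) at hau
  have hus : u • (θ : E) ∈ B.c.source := B.smul_mem_source θ (by linarith [B.δ_pos]) hu2
  have hout : B.c (u • (θ : E)) ∈ B.c '' {y : E | 1 ≤ ‖y‖ ∧ ‖y‖ < 1 + B.ε} :=
    ⟨_, ⟨by rw [norm_smul_sphere θ (by linarith)]; exact hu1.le, by rw [norm_smul_sphere θ (by linarith)]; exact hu2⟩, rfl⟩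
  rcases ha.lt_or_eq with hlt | heq
  · exact Set.disjoint_left.1 B.disjoint_outer hout ⟨a, mem_ball_zero_iff.2 hlt, hau⟩
  · have : B.ι a ∈ B.c '' sphere 0 1 := by rw [B.image_sphere]; exact ⟨a, mem_sphere_zero_iff_norm.2 heq, rfl⟩
    obtain ⟨z, hz, hza⟩ := this
    rw [mem_sphere_zero_iff_norm] at hz
    have hzs : z ∈ B.c.source := B.mem_source (by rw [hz]; linarith [B.δ_pos]) (by rw [hz]; linarith [B.ε_pos])
    have := B.injOn_c hzs hus (hza.trans hau)
    rw [this, norm_smul_sphere θ (by linarith)] at hz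
    linarith

/-- A point of the unit collar sphere is not a cap point. [folklore] -/
theorem inl_c_ne_inr {b : E} (hb : ‖b‖ = 1) (hmem : B.c b ∈ B.nearSet) (y : E) :
    B.near.glueData.inl ⟨B.c b, hmem⟩ ≠ B.near.glueData.inr y := by
  have : B.c b ∈ B.ι '' sphere 0 1 := by rw [← B.image_sphere]; exact ⟨b, mem_sphere_zero_iff_norm.2 hb, rfl⟩
  obtain ⟨a, ha, hab⟩ := this
  rw [mem_sphere_zero_iff_norm] at ha
  have hmem' : B.ι a ∈ B.nearSet := by rw [hab]; exact hmem
  have := B.inl_ι_ne_inr ha.le hmem' y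
  intro h
  apply this
  rw [← h]
  congr 1
  exact Subtype.ext hab

/-! #### Injectivity -/

/-- `F_A` is injective. [folklore] -/
theorem injective_FA : Injective B.FA := B.isSmoothEmbedding_FA.isEmbedding.injective

/-- `F_B` is injective on the closed unit ball. [folklore] -/
theorem injOn_FB : InjOn B.FB (closedBall 0 1) := by
  intro x hx y hy hxy
  rw [mem_closedBall_zero_iff] at hx hy
  rcases hx.lt_or_eq with hx1 | hx1 <;> rcases hy.lt_or_eq with hy1 | hy1
  · rw [B.FB_of_norm_lt_one hx1, B.FB_of_norm_lt_one hy1] at hxy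
    exact injOn_capDisc (mem_ball_zero_iff.2 hx1) (mem_ball_zero_iff.2 hy1) (B.near.glueData.inr_injective hxy)
  · rw [B.FB_of_norm_lt_one hx1, B.FB_of_norm_eq_one hy1] at hxy
    exact absurd hxy.symm (B.inl_c_ne_inr hy1 _ _)
  · rw [B.FB_of_norm_eq_one hx1, B.FB_of_norm_lt_one hy1] at hxy
    exact absurd hxy (B.inl_c_ne_inr hx1 _ _)
  · rw [B.FB_of_norm_eq_one hx1, B.FB_of_norm_eq_one hy1] at hxy
    have h := congrArg Subtype.val (B.near.glueData.inl_injective hxy)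
    change B.c x = B.c y at h
    exact B.injOn_c (B.mem_source (by rw [hx1]; linarith [B.δ_pos]) (by rw [hx1]; linarith [B.ε_pos]))
      (B.mem_source (by rw [hy1]; linarith [B.δ_pos]) (by rw [hy1]; linarith [B.ε_pos])) h

/-! #### The cover and the meeting relation -/

/-- Every cap point is a value of `F_B` on the open unit ball. [folklore] -/
theorem inr_mem_image_FB (y : E) : B.near.glueData.inr y ∈ B.FB '' closedBall 0 1 := by
  haveI : Nontrivial E := Module.nontrivial_of_finrank_eq_succ (Fact.out : finrank ℝ E = n + 1)
  obtain ⟨z, hz, hzy⟩ := exists_capDisc_eq y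
  exact ⟨z, mem_closedBall_zero_iff.2 hz.le, by rw [B.FB_of_norm_lt_one hz, hzy]⟩

/-- **The two discs cover the capped near side.** [folklore] -/
theorem union_eq : B.FA '' closedBall 0 1 ∪ B.FB '' closedBall 0 1 = univ := by
  refine eq_univ_of_forall fun p => ?_
  rcases B.near.glueData.exists_inl_or_inr p with ⟨a, rfl⟩ | ⟨y, rfl⟩
  · have ha : (a : P) ∈ B.nearSet := a.2
    rcases ha with ⟨x, hx, hxa⟩ | ⟨y, ⟨hy1, hy2⟩, hya⟩
    · left
      refine ⟨x, ball_subset_closedBall hx, ?_⟩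
      rw [B.FA_apply_of_norm_le (le_of_lt (mem_ball_zero_iff.1 hx)) (hxa ▸ a.2)]
      congr 1
      exact Subtype.ext hxa
    · right
      rcases hy1.lt_or_eq with hlt | heq
      · -- a point of the flipped half-neck is a cap point
        have hy0 : y ≠ 0 := by rintro rfl; rw [norm_zero] at hlt; linarith
        set θ : sphere (0 : E) 1 := unitDir (unitSpherePoint n) y
        set τ : ℝ := collarRadInv B.ε ‖y‖ with hτ
        have hyI : ‖y‖ ∈ Ioo 1 (1 + B.ε) := ⟨hlt, hy2.trans (collarRad_lt B.ε_pos 0)⟩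
        have hrτ : collarRad B.ε τ = ‖y‖ := collarRad_collarRadInv B.ε_pos hyI
        have hτneg : 0 < -τ := by
          rw [neg_pos, ← collarRad_lt_zero_iff B.ε_pos, hrτ]; exact hy2
        have hneck : B.neck (θ, -(-τ)) = (a : P) := by
          rw [neg_neg, neck_apply, hrτ, norm_smul_coe_unitDir _ hy0, hya]
        have key := B.near.inl_eq_inr θ hτneg
        have : B.near.glueData.inl a = B.near.glueData.inr ((-τ) • (θ : E)) := by
          rw [← key]; congr 1; exact Subtype.ext hneck.symm
        rw [this]
        exact B.inr_mem_image_FB _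
      · refine ⟨y, mem_closedBall_zero_iff.2 heq.symm.le, ?_⟩
        rw [B.FB_of_norm_eq_one heq.symm]
        congr 1
        exact Subtype.ext hya
  · exact Or.inr (B.inr_mem_image_FB y)

/-- **The two discs meet only in images of unit vectors.** [folklore] -/
theorem norm_eq_one_of_eq {a : E} (ha : a ∈ closedBall (0 : E) 1) {b : E} (hb : b ∈ closedBall (0 : E) 1)
    (h : B.FA a = B.FB b) : ‖a‖ = 1 ∧ ‖b‖ = 1 := by
  rw [mem_closedBall_zero_iff] at ha hb
  rw [B.FA_apply_of_norm_le ha (B.ι_mem_nearSet ha)] at h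
  have hb1 : ‖b‖ = 1 := by
    rcases hb.lt_or_eq with hlt | heq
    · rw [B.FB_of_norm_lt_one hlt] at h
      exact absurd h (B.inl_ι_ne_inr ha _ _)
    · exact heq
  refine ⟨?_, hb1⟩
  rw [B.FB_of_norm_eq_one hb1] at h
  have h' := congrArg Subtype.val (B.near.glueData.inl_injective h)
  change B.ι a = B.c b at h'
  have : B.ι a ∈ B.ι '' sphere 0 1 := by
    rw [← B.image_sphere]; exact ⟨b, mem_sphere_zero_iff_norm.2 hb1, h'.symm⟩
  obtain ⟨a', ha', haa⟩ := this
  rw [← B.isSmoothEmbedding_ι.isEmbedding.injective haa]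
  exact mem_sphere_zero_iff_norm.1 ha'

/-- **The two boundary spheres agree**: `F_A (𝕊) = inl (ι (𝕊)) = inl (c (𝕊)) = F_B (𝕊)`. [folklore] -/
theorem image_sphere_FA_FB : B.FA '' sphere 0 1 = B.FB '' sphere 0 1 := by
  apply Subset.antisymm
  · rintro _ ⟨a, ha, rfl⟩
    rw [mem_sphere_zero_iff_norm] at ha
    have : B.ι a ∈ B.c '' sphere 0 1 := by rw [B.image_sphere]; exact ⟨a, mem_sphere_zero_iff_norm.2 ha, rfl⟩
    obtain ⟨b, hb, hba⟩ := this
    rw [mem_sphere_zero_iff_norm] at hb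
    refine ⟨b, mem_sphere_zero_iff_norm.2 hb, ?_⟩
    rw [B.FB_of_norm_eq_one hb, B.FA_apply_of_norm_le ha.le (B.ι_mem_nearSet ha.le)]
    congr 1; exact Subtype.ext hba
  · rintro _ ⟨b, hb, rfl⟩
    rw [mem_sphere_zero_iff_norm] at hb
    have : B.c b ∈ B.ι '' sphere 0 1 := by rw [← B.image_sphere]; exact ⟨b, mem_sphere_zero_iff_norm.2 hb, rfl⟩
    obtain ⟨a, ha, hab⟩ := this
    rw [mem_sphere_zero_iff_norm] at ha
    refine ⟨a, mem_sphere_zero_iff_norm.2 ha, ?_⟩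
    rw [B.FB_of_norm_eq_one hb, B.FA_apply_of_norm_le ha.le (B.ι_mem_nearSet ha.le)]
    congr 1; exact Subtype.ext hab

/-! #### Injectivity of the differentials -/

/-- `1 ≤ ∞` in `WithTop ℕ∞`. [folklore] -/
theorem one_le_infty : (1 : WithTop ℕ∞) ≤ ∞ := by exact_mod_cast le_top

/-- The differential of `F_A` is injective everywhere. [folklore] -/
theorem injective_mfderiv_FA (x : E) : Injective (mfderiv 𝓘(ℝ, E) 𝓘(ℝ, E) B.FA x) :=
  mfderiv_injective_of_isImmersion B.isSmoothEmbedding_FA.isImmersion one_le_infty x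

/-- The differential of `inr ∘ G` is injective on the open unit ball. [folklore] -/
theorem injective_mfderiv_inr_capDisc {x : E} (hx : ‖x‖ < 1) :
    Injective (mfderiv 𝓘(ℝ, E) 𝓘(ℝ, E) (fun y => B.near.glueData.inr (capDisc y)) x) := by
  have hG : MDifferentiableAt 𝓘(ℝ, E) 𝓘(ℝ, E) (capDisc : E → E) x :=
    (contMDiffAt_iff_contDiffAt.2 (contDiffAt_capDisc hx)).mdifferentiableAt (by simp)
  have hinr : MDifferentiableAt 𝓘(ℝ, E) 𝓘(ℝ, E) B.near.glueData.inr (capDisc x) :=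
    B.near.glueData.contMDiff_inr.mdifferentiableAt (by simp)
  rw [show (fun y => B.near.glueData.inr (capDisc y)) = B.near.glueData.inr ∘ capDisc from rfl,
    mfderiv_comp x hinr hG]
  intro v w hvw
  rw [ContinuousLinearMap.comp_apply, ContinuousLinearMap.comp_apply] at hvw
  have h2 := (mfderiv_injective_of_isImmersion B.near.glueData.isSmoothEmbedding_inr.isImmersion one_le_infty
    (capDisc x)) hvw
  rw [mfderiv_eq_fderiv] at h2
  exact injective_fderiv_capDisc hx h2

omit [T2Space P] [IsManifold 𝓘(ℝ, E) ∞ P] in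
/-- The differential of `c ∘ rimMap` is injective on the window (local left inverse
`rimMap⁻¹ ∘ c⁻¹`). [folklore] -/
theorem injective_mfderiv_c_rimMap {x : E} (hx : x ∈ B.rimWindow) :
    Injective (mfderiv 𝓘(ℝ, E) 𝓘(ℝ, E) (fun y => B.c (rimMap B.ε y)) x) := by
  have h0 := B.ne_zero_of_mem_rimWindow hx
  have hsrc := B.rimMap_mem_source hx
  have hf : MDifferentiableAt 𝓘(ℝ, E) 𝓘(ℝ, E) (fun y => B.c (rimMap B.ε y)) x :=
    ((B.contMDiffOn_c.contMDiffAt (B.c.open_source.mem_nhds hsrc)).comp x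
      (contMDiffAt_iff_contDiffAt.2 (contDiffAt_rimMap h0))).mdifferentiableAt (by simp)
  have hne : rimMap B.ε x ≠ 0 := by
    rw [← norm_pos_iff, norm_rimMap h0 (B.rimRad_pos hx)]; exact B.rimRad_pos hx
  have hg : MDifferentiableAt 𝓘(ℝ, E) 𝓘(ℝ, E) (fun p => rimMapInv B.ε (B.c.symm p)) (B.c (rimMap B.ε x)) := by
    have h1 : ContMDiffAt 𝓘(ℝ, E) 𝓘(ℝ, E) ∞ B.c.symm (B.c (rimMap B.ε x)) :=
      B.contMDiffOn_c_symm.contMDiffAt (B.c.open_target.mem_nhds (B.c.map_source hsrc))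
    have h2 : ContMDiffAt 𝓘(ℝ, E) 𝓘(ℝ, E) ∞ (rimMapInv B.ε : E → E) (B.c.symm (B.c (rimMap B.ε x))) := by
      rw [B.c.left_inv hsrc]
      exact contMDiffAt_iff_contDiffAt.2 (contDiffAt_rimMapInv hne)
    exact (h2.comp _ h1).mdifferentiableAt (by simp)
  refine mfderiv_injective_of_eventuallyEq_leftInverse hf hg ?_
  -- `rimMap⁻¹ (c⁻¹ (c (rimMap y))) = y` near `x`
  filter_upwards [B.isOpen_rimWindow.mem_nhds hx] with y hy
  simp only [comp_apply, id_eq]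
  rw [B.c.left_inv (B.rimMap_mem_source hy),
    rimMapInv_rimMap B.ε_pos (B.ne_zero_of_mem_rimWindow hy) (B.rimRad_pos hy)]

/-- The differential of the rim lift is injective on the window. [folklore] -/
theorem injective_mfderiv_rimLift {x : E} (hx : x ∈ B.rimWindow) :
    Injective (mfderiv 𝓘(ℝ, E) 𝓘(ℝ, E) B.rimLift x) := by
  have hk : MDifferentiableAt 𝓘(ℝ, E) 𝓘(ℝ, E) B.rimLift x := (B.contMDiffAt_rimLift hx).mdifferentiableAt (by simp)
  have hval : MDifferentiableAt 𝓘(ℝ, E) 𝓘(ℝ, E) (Subtype.val : B.near.side → P) (B.rimLift x) :=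
    (contMDiff_subtype_val (n := ∞)).mdifferentiableAt (by simp)
  have hcomp : mfderiv 𝓘(ℝ, E) 𝓘(ℝ, E) (Subtype.val ∘ B.rimLift) x =
      (mfderiv 𝓘(ℝ, E) 𝓘(ℝ, E) (Subtype.val : B.near.side → P) (B.rimLift x)).comp
        (mfderiv 𝓘(ℝ, E) 𝓘(ℝ, E) B.rimLift x) := mfderiv_comp x hval hk
  have hev : (Subtype.val ∘ B.rimLift) =ᶠ[𝓝 x] fun y => B.c (rimMap B.ε y) :=
    Filter.eventuallyEq_of_mem (B.isOpen_rimWindow.mem_nhds hx) fun y hy => B.coe_rimLift hy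
  have hinj := B.injective_mfderiv_c_rimMap hx
  rw [← hev.mfderiv_eq, hcomp] at hinj
  exact Injective.of_comp hinj

/-- The differential of `inl ∘ rimLift` is injective on the window. [folklore] -/
theorem injective_mfderiv_inl_rimLift {x : E} (hx : x ∈ B.rimWindow) :
    Injective (mfderiv 𝓘(ℝ, E) 𝓘(ℝ, E) (fun y => B.near.glueData.inl (B.rimLift y)) x) := by
  have hk : MDifferentiableAt 𝓘(ℝ, E) 𝓘(ℝ, E) B.rimLift x := (B.contMDiffAt_rimLift hx).mdifferentiableAt (by simp)
  have hinl : MDifferentiableAt 𝓘(ℝ, E) 𝓘(ℝ, E) B.near.glueData.inl (B.rimLift x) :=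
    B.near.glueData.contMDiff_inl.mdifferentiableAt (by simp)
  rw [show (fun y => B.near.glueData.inl (B.rimLift y)) = B.near.glueData.inl ∘ B.rimLift from rfl,
    mfderiv_comp x hinl hk]
  exact (mfderiv_injective_of_isImmersion B.near.glueData.isSmoothEmbedding_inl.isImmersion one_le_infty _).comp
    (B.injective_mfderiv_rimLift hx)

/-- The differential of `F_B₀` is injective on `B(0, 1 + η)`. [folklore] -/
theorem injective_mfderiv_FB₀ {x : E} (hx : ‖x‖ < 1 + B.η) : Injective (mfderiv 𝓘(ℝ, E) 𝓘(ℝ, E) B.FB₀ x) := by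
  rcases B.lt_one_or_mem_rimWindow hx with h | h
  · have hev : B.FB₀ =ᶠ[𝓝 x] fun y => B.near.glueData.inr (capDisc y) :=
      Filter.eventuallyEq_of_mem (isOpen_ball.mem_nhds (mem_ball_zero_iff.2 h)) fun y hy =>
        B.FB₀_of_lt (mem_ball_zero_iff.1 hy)
    rw [hev.mfderiv_eq]
    exact B.injective_mfderiv_inr_capDisc h
  · have hev : B.FB₀ =ᶠ[𝓝 x] fun y => B.near.glueData.inl (B.rimLift y) :=
      Filter.eventuallyEq_of_mem (B.isOpen_rimWindow.mem_nhds h) fun y hy => B.FB₀_eq_of_mem_rimWindow hy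
    rw [hev.mfderiv_eq]
    exact B.injective_mfderiv_inl_rimLift h

/-- **The differential of `F_B` is injective on the closed unit ball** (there `ballStretch` is the
identity, with invertible differential). [folklore] -/
theorem injective_mfderiv_FB {x : E} (hx : x ∈ closedBall (0 : E) 1) : Injective (mfderiv 𝓘(ℝ, E) 𝓘(ℝ, E) B.FB x) := by
  rw [mem_closedBall_zero_iff] at hx
  have hbs : MDifferentiableAt 𝓘(ℝ, E) 𝓘(ℝ, E) (ballStretch B.RB : E → E) x :=
    (contMDiffAt_iff_contDiffAt.2 (contDiff_ballStretch B.one_lt_RB).contDiffAt).mdifferentiableAt (by simp)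
  have hx' : ‖ballStretch B.RB x‖ < 1 + B.η := by rw [ballStretch_eq_self B.one_lt_RB hx]; linarith [B.η_pos]
  have hF : MDifferentiableAt 𝓘(ℝ, E) 𝓘(ℝ, E) B.FB₀ (ballStretch B.RB x) :=
    (B.contMDiffAt_FB₀ hx').mdifferentiableAt (by simp)
  rw [show B.FB = B.FB₀ ∘ ballStretch B.RB from rfl, mfderiv_comp x hF hbs]
  intro v w hvw
  have hvw' : mfderiv 𝓘(ℝ, E) 𝓘(ℝ, E) B.FB₀ (ballStretch B.RB x) (mfderiv 𝓘(ℝ, E) 𝓘(ℝ, E) (ballStretch B.RB) x v) =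
      mfderiv 𝓘(ℝ, E) 𝓘(ℝ, E) B.FB₀ (ballStretch B.RB x) (mfderiv 𝓘(ℝ, E) 𝓘(ℝ, E) (ballStretch B.RB) x w) := hvw
  have h2 := (B.injective_mfderiv_FB₀ hx') hvw'
  rw [mfderiv_eq_fderiv] at h2
  exact injective_fderiv_ballStretch B.one_lt_RB x h2

end BallCollarData

end TwoDiscs

/-! ### §7 Assembly: the two-disc cover, and `Ŷ ≅ S⁴` given Cerf -/

section Assembly

attribute [local instance] fact_finrank_euclideanSpace_succ

variable {n : ℕ} {P : Type*} [TopologicalSpace P] [ChartedSpace (EuclideanSpace ℝ (Fin (n + 1))) P]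
  [T2Space P] [IsManifold (𝓡 (n + 1)) ∞ P] (B : BallCollarData (EuclideanSpace ℝ (Fin (n + 1))) n P)

/-- **The capped near side of a collared ball is covered by two ambient discs** (the closed ball
piece and the cap with the half-collar). [cite: Hamilton1997, §1.1 pp. 3–4] -/
def BallCollarData.twoDiscCover : SmoothTwoDiscCover n B.near.Capped where
  FA := B.FA
  FB := B.FB
  contMDiff_FA := B.isSmoothEmbedding_FA.contMDiff
  contMDiff_FB := B.contMDiff_FB
  injOn_FA := B.injective_FA.injOn
  injOn_FB := B.injOn_FB
  injective_mfderiv_FA := fun y _ => B.injective_mfderiv_FA y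
  injective_mfderiv_FB := fun _ hy => B.injective_mfderiv_FB hy
  union_eq := B.union_eq
  norm_eq_one_of_eq := fun _ ha _ hb h => B.norm_eq_one_of_eq ha hb h
  image_sphere_eq := B.image_sphere_FA_FB

/-- Hence the capped near side is a twisted sphere `𝔻ⁿ⁺¹ ∪_φ 𝔻ⁿ⁺¹`. [cite: KervaireMilnor1963, §1] -/
theorem BallCollarData.exists_isTwistedSphere_near :
    ∃ φ : (sphere (0 : EuclideanSpace ℝ (Fin (n + 1))) 1) ≃ₘ⟮𝓡 n, 𝓡 n⟯
      (sphere (0 : EuclideanSpace ℝ (Fin (n + 1))) 1), IsTwistedSphere n φ B.near.Capped :=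
  B.twoDiscCover.exists_isTwistedSphere

/-- **Given Cerf's `Γ₄ = 0`, the capped near side of a collared ball in a compact Hausdorff
4-manifold is diffeomorphic to `S⁴`** (`SmoothTwoDiscCover.nonempty_diffeomorph_sphere_four`).
This is the piece "thrown away" at a surgery read in the charts of the next stage (Hamilton 1997,
§1.1 p. 3: "If one of these pieces is diffeomorphic to one of the standard models, we throw it
away"). [cite: Hamilton1997, §1.1 pp. 3–4] [cite: Cerf1968, main theorem (Γ₄ = 0)] -/
theorem BallCollarData.nonempty_diffeomorph_sphere_four (hC : cerf_twistedSphere_four) {P : Type}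
    [TopologicalSpace P] [ChartedSpace (EuclideanSpace ℝ (Fin 4)) P] [T2Space P] [CompactSpace P]
    [IsManifold (𝓡 4) ∞ P] (B : BallCollarData (EuclideanSpace ℝ (Fin 4)) 3 P) :
    Nonempty (B.near.Capped ≃ₘ⟮𝓡 4, 𝓡 4⟯ (sphere (0 : EuclideanSpace ℝ (Fin 5)) 1)) :=
  B.twoDiscCover.nonempty_diffeomorph_sphere_four hC

end Assembly

end Literature.Topology.FourManifolds

end
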